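/-
Copyright: lit-balaban Phase-2 proof seat p34 (gen 21).  Statement-level skeleton of a published paper; no proof claims beyond what the
kernel checks below.
-/
import Literature.MathematicalPhysics.QuantumFieldTheory.BalabanImbrieJaffe1984to88.BIJ88NeumannPropagatorSmallFieldClose
import Literature.MathematicalPhysics.QuantumFieldTheory.BalabanImbrieJaffe1984to88.BIJ88NeumannPropagatorSmoothNearRegion

/-!
# [BalabanImbrieJaffe1988] p. 263 (2.31) WITH ITS PRINTED LOCAL HYPOTHESIS (2.32) ⟵ [Balaban1983RegularityDecay] Theorem p. 573 (1.11)–(1.12):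
# **the `δG_k(□, Ω)` VALUE MEMBER at `U(1)` fields that are plaquette-small NEAR `Ω` ONLY** — `|(G_k(□,u)f)(x) − (G_k(Ω,u)f)(x)| ≤
# (L^kε)²c₁e^{−δ₁dist(x,supp f)/L^k}e^{−δ₁(dist(x,□^c)+dist(supp f,□^c))/L^k}‖f‖_∞` on the deep rows of nested `k`-block unions `□ ⊆ Ω`,
# uniformly in `k`, in the (H1.12″) binder shape of p31's `BIJ88DeltaLocClose235General.opClose231_gen` (file C-I of the TAKING; file
# C-II = (2.31)/(2.35) for regions under the same local hypothesis)

T. Bałaban, J. Imbrie, A. Jaffe, *Effective action and cluster properties of the abelian Higgs model*, Commun. Math. Phys. **114** (1988)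
257–315 [BalabanImbrieJaffe1988], Sect. 2 p. 263 [PDF 7]: *"|(G_{k,loc}(u)f − G_k(Ω,u)f)(x)| ≦ e^{−cr(e_k)}e^{−c dist(suppt f,x)}‖f‖_∞ for
dist(x, Ω^c) ≧ O(r(e_k)). (2.31) [Each G_k(□_α, u) is close to G_k(Ω, u) for the relevant x₁, x₂, therefore the convex combination and G_{k,loc}
are close also.] We assume that u is smooth in the □_α's entering the sum in (2.27); for (2.31) we assume smoothness throughout the subset
Ω ⊂ T_η. This means that in a neighborhood of each □_α there exists an A, λ such that u = exp[ie_kη(A + ∂λ)] with |∂A|, |∂*A| ≦ O(p(e_k)).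
(2.32)"*; [I] = T. Bałaban, J. Imbrie, A. Jaffe, *Renormalization of the Higgs model: minimizers, propagators and the stability of mean field
theory*, Commun. Math. Phys. **97** (1985) 299–329 [BalabanImbrieJaffe1985], §7.3 p. 326 [PDF 28]: *"The propagators arising from Δ_k(u_k) …
also satisfy the regularity and decay estimates of [7]. In order to remain within the framework of this reference, we remark that by change of
gauge u_k can be transformed in a local region Λ into a configuration of the form exp[ie_kηA], where A is smooth and small."*; [6] = [7] of [I] =
T. Bałaban, *Regularity and decay of lattice Green's functions*, Commun. Math. Phys. **89** (1983) 571–597 [Balaban1983RegularityDecay], Theorem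
p. 573 [PDF 3]: *"If Ω ⊂ Ω₀, then for δG_k(Ω,Ω₀,A) defined by the equality δG_k(Ω,Ω₀,A) = G_k(Ω,A) − G_k(Ω₀,A), (1.11) we have the inequalities
(1.5) and (1.6) (with the same restrictions on x, x′) with the additional factor (1.12) [= exp(−δ₀dist(x, Ω^c))exp(−δ₀dist(supp f, Ω^c))] on the
right hand sides"*.

statement-level skeleton of published theorems with citation tags; proofs where landed; nothing here is a claim about the Yang–Mills mass gap

PDFs held: `paper:balaban1988-cmp114-bij-abelian-higgs-effective-action` (journal page = PDF page + 256; p. 263 = PDF 7);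
`paper:balaban1985-cmp97-bij-higgs-minimizers` (p. 326 = PDF 28); `paper:balaban1983-cmp89-regularity-decay` (p. 573 = PDF 3).

CITATION HEADER (lean-in-tree rule).  Part of the lit-balaban TYPED SKELETON (HOME `run/shared/lean/pub/lit-balaban/`), PHASE-2 proof seat
p34 gen 21 (unit `lit-balaban-p34-g21`; TAKING line HOME/STATUS.md 2026-08-23T12:07:14Z; free-target protocol G.5-34(d)).  WHAT IS
REPRODUCED: a located MEMBER of rows **C2.Eq2.31** / **C2.Claim@263** (owner r18) in the NEW row «u smooth NEAR Ω only — the printed (2.32)»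
of r18's `C2S14-CLOSURE.md` §6 (v1.20: *"the (2.31)/(2.35) CLOSENESS conclusions under (2.32) = OPEN (any seat; S–M: p31's
`BIJ88DeltaLocClose235General` / p30's `close112` region members re-fed with these local inputs)"*), and r15's **C1.Eq7.3.1-7.3.2** /
**C1.Claim@326** (located members, cells only): the (H1.12″) CLOSENESS INPUT `δG_k(□, Ω)` of p31's `(2.31) ⟸ (1.10)–(1.12)` chain when the
gauge field is plaquette-small ONLY on the plaquettes based within `2L^k` of `Ω` — p30's `BIJ88NeumannPropagatorSmallFieldClose` took the
plaquette smallness on the WHOLE torus, and it did so at exactly ONE place: the coercivity `coercive_opT` ⟵ p11's multiscale `massBound_small`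
(whole-torus telescoping) inside the Agmon bound `BIJ85SmallFieldHarmonicAgmon.agmon_harmonic`.  Here the Agmon bound is re-run with the
coercivity as a HYPOTHESIS (`agmon_harmonic_of_coercive`), and the coercivity of the torus form on fields supported in a `k`-block union `X`
is supplied from the `k`-block Poincaré inequality of the blocks of `X` ALONE (p34 gen 16's `coercive_region_poincare`) in the blockwise tree
gauge of [I] p. 326 that reads only the plaquettes based within `2L^k` of `X` (p34 gen 20's `blockGauge_of_near`).  No row is restated and no
head changes.  USED BY NAME, never restated: p30's `energy_wmul_le_of_harmonic` (IMS localisation), `harmonic_meanValue` (sibling 2 — its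
hypotheses are local: harmonicity on a `(4L^k+2)`-ball, bond smallness on a `2L^k`-ball), `nOp_univ_diff_apply_eq_zero`, `exists_depth` /
`depth_le_add` / `mem_of_depth_pos` / `interior_of_depth_two` / `cutoff_props` / `tilt_lipschitz` / `nOp_gaugeAct_mulVec_smul` /
`supDist_le_half` (`BIJ88NeumannPropagatorSmallFieldClose`), `gamma_nsq_le_one` (`BIJ85ScalarPropagatorSupDecayDeriv`),
`BIJ85FreeResolventTiltedRow.sum_exp_neg_supDist_scale_le`; p34 gen 16's `coercive_region_poincare` (`BIJ88NeumannPropagatorSmallFieldRegion`),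
gen 20's `blockGauge_of_near` / `dist1_centredGaugeDir_le_supDist_of_near` / `plaqSmall_near_of_smoothOn` (`BIJ88NeumannPropagatorSmoothNearRegion`);
p31's `nOp` / `gBox`; p33/p11's `wmul`, `Dlin`, `QlinK`, `opT`, `inner_opT`, `norm_Dlin_sq'`, `norm_QlinK_sq`, `sum_norm_sq_eq`; r18's `SmoothOn`.
PRIVATE kernels of p30's two files that a downstream file cannot name (`osc_weight_sq_le`, `agmon_bond_le`, `agmon_block_le`, the sum
bookkeeping, `exp_budget`, `collar_pointwise`, `ball_mass_le`, `sqrt_step`, `alpha_mul_eps_sq`) are COPIED here verbatim as private kernels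
with p30's tags — attribution: p30 gens 27–28.  Kind: theorems only (no definition, no `Prop`-valued fact).

THE MATHEMATICS (why the local hypothesis suffices).  In p30's proof of (1.11)–(1.12) the function `v = G_k(□,u)f − G_k(Ω,u)f` is
`N(u)`-harmonic on the interior of `□`; the Agmon weight `ω = ηe^{g}` VANISHES at depth `≤ L^k + 2` below `T ∖ □`, so `ωv` is supported inside `□`,
where the torus form `‖D_u(ωv)‖² + a‖Q_k(u)(ωv)‖²` DOMINATES the Neumann form of `□` (fewer bonds, fewer blocks), which is coercive by the
`k`-block Poincaré inequality of the blocks of `□` alone under the bondwise smallness `|u^h_b − 1| ≤ T` (intra-block bonds of `□*`),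
`|u^h(Γ^{(k)}) − 1| ≤ δ` (on `□`) delivered by the blockwise tree gauge `h` from the plaquettes based within `2L^k` of `□ ⊆ Ω`; everything is moved
through `h` by gauge covariance (`N(u^h)(h·w) = h·N(u)w`, `|h| = 1`).  The mean-value step reads plaquettes within `2L^k + 2 ≤ 10L^k` of the deep
row `x`, i.e. inside `□`.  Hence p30's conclusion holds VERBATIM when `‖u(∂p) − 1‖ ≤ θ` is known only for the plaquettes based within `2L^k` of
`Ω` (a vortex in a hole of `Ω` is allowed), with the thresholds of the gen-16/18/20 region members.

WHAT IS PROVED (theorems only; 0 `sorry`; standard axioms; no definition, no `Prop`-valued fact).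
* §1 **`agmon_harmonic_of_coercive`** — p30's `agmon_harmonic` with the coercivity `m‖ωφ‖² ≤ ⟨ωφ, T(ωφ)⟩` of the weighted field as a
  HYPOTHESIS (any `m`; tilt condition `… ≤ m/2`): `(m/2)Σ(ηe^g)²‖φ‖² ≤ e^{2t}ℓ⁻²(2dc² + aN⁻¹n²)Σ_{S}e^{2g}‖φ‖²`; every `U(1)` field, `a ≥ 0`.
* §2 **`coercive_univ_of_region`** — for a `k`-block union `X`, `|u_b − 1| ≤ T` on the intra-block bonds of `X*`, `|u(Γ^{(k)}_{y_k,y}) − 1| ≤ δ`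
  on `X`, `2(n−1)n·d·T² + 2δ² ≤ 1/2`, and every `χ` supported in `X`: `min(c²/(4n²), a/(4N))·‖χ‖² ≤ ⟨χ, (D_u^*D_u + aQ_k(u)^*Q_k(u))χ⟩`
  (the TORUS form; gen 16's `coercive_region_poincare` + domination of the Neumann sums by the torus sums);
  **`agmon_step_region`** — p30's k-uniform `agmon_step` for `N(u)`-harmonic `ψ` with the cutoff supported in `X`, under the bondwise
  hypotheses on `X` (`m_* = min(a(1 − L^{−2})/4, 1/4)`); **`agmon_step_near`** — the same under `‖u(∂p) − 1‖ ≤ θ` for the plaquettes based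
  within `2L^k` of `X` only (`T ≥ (d−1)(L^k−1)θ`, `2(L^k−1)L^k·d·T² + 2(d(L^k−1)T)² ≤ 1/2`, `2(L^k−1)+4 < |T|`), via the blockwise gauge.
* §3 **`close112_smoothNear_of_inputs`** — p30's `close112_smallField_of_inputs` VERBATIM IN SHAPE with the global plaquette hypothesis
  replaced by `∀ p, (∃ y ∈ Ω, |y − p.src|_∞ ≤ 2L^k) → ‖u(∂p) − 1‖ ≤ θ` plus the displayed thresholds (`2d³(L^{2k}θ)² ≤ 1` for the mean-value
  gauge, `(T, ½)` for the coercivity); **`close112_smoothNear_hC`** — literally hypothesis `hC` of `opClose231_gen` for a family of `k`-block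
  unions `□_α ⊆ Ω`; **`close112_smoothOn_hC`** — the same UNDER THE PRINTED (2.32) near `Ω` (r18's `SmoothOn e_k η C 𝓅 X B Pl (cfg u)`,
  `Pl ⊇` the plaquettes based within `2L^k` of `Ω`, `B ⊇` their bonds; `θ = e_kη²C𝓅`).
HONEST SCOPE.  (i) `U(1)` only, `2 ≤ d ≤ 3`, `L` odd `> 1`, `1 ≤ k ≤ K`, rows at sup-depth `≥ 10L^k` below `T ∖ □`, VALUE member only — as p30's
file (its HONEST SCOPE (i)–(v) and DIVERGENCE OF METHOD — energy/Agmon/mean-value instead of [6]'s random walk — apply verbatim).  (ii) The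
hypothesis is LOCAL as printed, in the tree's currency (plaquette smallness on the plaquettes BASED within `2L^k` of `Ω`; (2.32) via `SmoothOn`
with the divergence clause and the site set unused); the coercivity threshold is the `(T, ½)` condition of the gen-16/18/20 region members
(`θ ≲ 1/((d+1)²L^{2k})`), slightly stronger than p30's `2d³(L^{2k}θ)² ≤ 1`, which is kept for the mean-value gauge; both follow from p31's
`(L^{2k}θ)² ≤ 1/500` (`smallness_of_threshold`, file C-II).  (iii) The (H1.10″) members for `□` and `Ω` are HYPOTHESES as in p30's file; under
the local hypothesis they are instantiated by gen 20's `decay110_smoothNear_region` (file C-II).  (iv) Constants explicit in the proof, from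
`(d, L, a, c₀, δ₀)` only; `m_*` is a quarter of p30's (the region Poincaré inequality is used with absorbed constant `½`).  Literature + Mathlib
only.  Nothing here is summit progress, continuum or Clay.  Unit `lit-balaban-p34` (literature-prover-lit-balaban-p34-g21-0), HOME
`run/shared/lean/pub/lit-balaban/`, 2026-08-23.
v1.1 (p34 gen 21, 2026-08-23): DOCFIX ONLY (referee ref-5 record note R-g74-1): in the p. 263 quotation «(2.27), and for (2.31)» → the printed
«(2.27); for (2.31)».  Declarations untouched.
-/

open scoped RealInnerProductSpace BigOperators ComplexConjugate
open Finset Matrix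

namespace Literature.MathematicalPhysics.QuantumFieldTheory.BalabanImbrieJaffe1984to88.BIJ88NeumannPropagatorSmoothNearClose

open Literature.MathematicalPhysics.QuantumFieldTheory.Balaban1983to89
open LatticeFieldCalculus (supDist)
open B3TorusRadialSums (supDist_comm supDist_eq_zero_iff)
open BIJ85Ineq722Torus (supDist_triangle)
open BIJ88Sect3Statements (U1 toC cfg covD starB mem_starB norm_toC toC_one toC_mul)
open BIJ85BlockAveragesTorus BIJ85BlockAveragesTorusK
open BIJ85ScalarPropagatorTorus BIJ85ScalarPropagatorTorusK
open BIJ85ScalarForm464 (opT inner_opT)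
open BIJ85AgmonDefect (wmul wmul_apply norm_wmul_sq sq_exp_sub_exp_le_of_abs_le)
open BIJ85BlockAveragingIneq (sum_bond_eq sum_sum_dir sum_sum_shift_dir)
open BIJ88NeumannNoZeroModesTorus (IsBlockUnion innerK mem_innerK)
open BIJ88NeumannPropagator227Torus (nOp gBox)
open BIJ85SmallFieldHarmonicAgmon (energy_wmul_le_of_harmonic supDist_le_of_mem_blockK sum_blockK_eq_sum)

noncomputable section

variable {P : Params} {j : ℕ}

/-! ## §1 The Agmon bound with the coercivity of the weighted field as a HYPOTHESIS (p30's `agmon_harmonic` re-run) -/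

section Agmon

/-- kernel: **symmetrisation of the block defect** — for a weight function `Wt` symmetric in `(x, x′)` and nonnegative,
`Σ_{x,x′∈B}Wt(x,x′)‖φ_x‖‖φ_{x′}‖ ≤ Σ_{x,x′∈B}Wt(x,x′)‖φ_x‖²` (p30's kernel, copied). [folklore] -/
private theorem double_sum_mul_le_sq {ι : Type*} (s : Finset ι) (Wt : ι → ι → ℝ) (hW : ∀ x x', Wt x x' = Wt x' x) (hW0 : ∀ x x', 0 ≤ Wt x x')
    (n : ι → ℝ) :
    ∑ x ∈ s, ∑ x' ∈ s, Wt x x' * (n x * n x') ≤ ∑ x ∈ s, ∑ x' ∈ s, Wt x x' * n x ^ 2 := by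
  have h1 : ∑ x ∈ s, ∑ x' ∈ s, Wt x x' * n x' ^ 2 = ∑ x ∈ s, ∑ x' ∈ s, Wt x x' * n x ^ 2 := by
    rw [Finset.sum_comm]
    exact Finset.sum_congr rfl fun x _ => Finset.sum_congr rfl fun x' _ => by rw [hW]
  have h2 : ∑ x ∈ s, ∑ x' ∈ s, Wt x x' * (n x * n x') ≤ ∑ x ∈ s, ∑ x' ∈ s, Wt x x' * ((n x ^ 2 + n x' ^ 2) / 2) :=
    Finset.sum_le_sum fun x _ => Finset.sum_le_sum fun x' _ =>
      mul_le_mul_of_nonneg_left (by nlinarith [sq_nonneg (n x - n x')]) (hW0 x x')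
  refine h2.trans (le_of_eq ?_)
  have h3 : ∑ x ∈ s, ∑ x' ∈ s, Wt x x' * ((n x ^ 2 + n x' ^ 2) / 2) =
      (∑ x ∈ s, ∑ x' ∈ s, Wt x x' * n x ^ 2 + ∑ x ∈ s, ∑ x' ∈ s, Wt x x' * n x' ^ 2) / 2 := by
    rw [← Finset.sum_add_distrib, Finset.sum_div]
    refine Finset.sum_congr rfl fun x _ => ?_
    rw [← Finset.sum_add_distrib, Finset.sum_div]
    exact Finset.sum_congr rfl fun x' _ => by ring
  rw [h3, h1]; ring

/-- kernel: `Σ_z Σ_μ [z+e_μ ∈ A]F(z+e_μ) = d·Σ_{x∈A}F(x)` (each shift is a bijection of the torus; p30's kernel, copied). [folklore] -/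
private theorem sum_sum_shift_indicator (A : Finset (Balaban1983to89.Site P j)) (F : Balaban1983to89.Site P j → ℝ) :
    ∑ z : Balaban1983to89.Site P j, ∑ μ : Fin P.d, (if z.shift μ ∈ A then F (z.shift μ) else 0) = P.d * ∑ x ∈ A, F x := by
  rw [sum_sum_shift_dir (fun x => if x ∈ A then F x else 0), ← Finset.sum_filter, Finset.filter_mem_eq_inter, Finset.univ_inter]

/-- kernel: `Σ_z Σ_μ [z ∈ A]F(z) = d·Σ_{x∈A}F(x)` (p30's kernel, copied). [folklore] -/
private theorem sum_sum_indicator (A : Finset (Balaban1983to89.Site P j)) (F : Balaban1983to89.Site P j → ℝ) :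
    ∑ z : Balaban1983to89.Site P j, ∑ _μ : Fin P.d, (if z ∈ A then F z else 0) = P.d * ∑ x ∈ A, F x := by
  rw [sum_sum_dir (fun x => if x ∈ A then F x else 0), ← Finset.sum_filter, Finset.filter_mem_eq_inter, Finset.univ_inter]

/-- kernel: `ab ≤ ½b² + ½a²` (p30's kernel, copied). [folklore] -/
private theorem mul_le_half_sq_add (a b : ℝ) : a * b ≤ (1 / 2) * b ^ 2 + (1 / 2) * a ^ 2 := by
  nlinarith [sq_nonneg (a - b)]

/-- kernel: the oscillation of the weight `ω = ηe^{g}` over a pair of sites: if `|g₁ − g₂| ≤ s` then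
`(η₁e^{g₁} − η₂e^{g₂})² ≤ 2e^{2s}((η₁ − η₂)²e^{2g₁} + s²(η₁e^{g₁})²)` (p30's kernel, copied). [folklore] -/
private theorem osc_weight_sq_le (η₁ η₂ : ℝ) {g₁ g₂ s : ℝ} (hgs : |g₁ - g₂| ≤ s) :
    (η₁ * Real.exp g₁ - η₂ * Real.exp g₂) ^ 2 ≤
      2 * Real.exp (2 * s) * ((η₁ - η₂) ^ 2 * Real.exp (2 * g₁) + s ^ 2 * (η₁ * Real.exp g₁) ^ 2) := by
  have hex0 := Real.exp_pos g₁
  have hex0' := Real.exp_pos g₂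
  have hes : Real.exp g₂ ≤ Real.exp s * Real.exp g₁ := by
    rw [← Real.exp_add]; refine Real.exp_le_exp.2 ?_
    have := (abs_le.1 hgs).1; linarith
  set p₁ : ℝ := (η₁ - η₂) * Real.exp g₂ with hp₁
  set p₂ : ℝ := η₁ * (Real.exp g₁ - Real.exp g₂) with hp₂
  have hdec : η₁ * Real.exp g₁ - η₂ * Real.exp g₂ = p₁ + p₂ := by rw [hp₁, hp₂]; ring
  have hsq : (p₁ + p₂) ^ 2 ≤ 2 * p₁ ^ 2 + 2 * p₂ ^ 2 := by nlinarith [sq_nonneg (p₁ - p₂)]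
  have h3 : Real.exp g₂ ^ 2 ≤ Real.exp (2 * s) * Real.exp (2 * g₁) := by
    have e1 : Real.exp (2 * s) * Real.exp (2 * g₁) = (Real.exp s * Real.exp g₁) ^ 2 := by
      rw [mul_pow, ← Real.exp_nat_mul, ← Real.exp_nat_mul]; push_cast; rfl
    rw [e1]; exact pow_le_pow_left₀ hex0'.le hes 2
  have hP₁ : p₁ ^ 2 ≤ (η₁ - η₂) ^ 2 * (Real.exp (2 * s) * Real.exp (2 * g₁)) := by
    rw [hp₁, mul_pow]; exact mul_le_mul_of_nonneg_left h3 (sq_nonneg _)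
  have h1 : (Real.exp g₁ - Real.exp g₂) ^ 2 ≤ s ^ 2 * Real.exp s * (Real.exp g₁ * Real.exp g₂) :=
    sq_exp_sub_exp_le_of_abs_le hgs
  have h2 : (Real.exp g₁ - Real.exp g₂) ^ 2 ≤ s ^ 2 * Real.exp (2 * s) * Real.exp g₁ ^ 2 := by
    refine h1.trans ?_
    have h4 : Real.exp g₁ * Real.exp g₂ ≤ Real.exp s * Real.exp g₁ ^ 2 :=
      calc Real.exp g₁ * Real.exp g₂ ≤ Real.exp g₁ * (Real.exp s * Real.exp g₁) := mul_le_mul_of_nonneg_left hes hex0.le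
        _ = Real.exp s * Real.exp g₁ ^ 2 := by ring
    have h5 : Real.exp s * Real.exp s = Real.exp (2 * s) := by rw [← Real.exp_add, two_mul]
    calc s ^ 2 * Real.exp s * (Real.exp g₁ * Real.exp g₂) ≤ s ^ 2 * Real.exp s * (Real.exp s * Real.exp g₁ ^ 2) :=
          mul_le_mul_of_nonneg_left h4 (by positivity)
      _ = s ^ 2 * Real.exp (2 * s) * Real.exp g₁ ^ 2 := by rw [← h5]; ring
  have hP₂ : p₂ ^ 2 ≤ η₁ ^ 2 * (s ^ 2 * Real.exp (2 * s) * Real.exp g₁ ^ 2) := by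
    rw [hp₂, mul_pow]; exact mul_le_mul_of_nonneg_left h2 (sq_nonneg _)
  calc (η₁ * Real.exp g₁ - η₂ * Real.exp g₂) ^ 2 = (p₁ + p₂) ^ 2 := by rw [hdec]
    _ ≤ 2 * p₁ ^ 2 + 2 * p₂ ^ 2 := hsq
    _ ≤ 2 * ((η₁ - η₂) ^ 2 * (Real.exp (2 * s) * Real.exp (2 * g₁))) + 2 * (η₁ ^ 2 * (s ^ 2 * Real.exp (2 * s) * Real.exp g₁ ^ 2)) :=
        add_le_add (mul_le_mul_of_nonneg_left hP₁ zero_le_two) (mul_le_mul_of_nonneg_left hP₂ zero_le_two)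
    _ = 2 * Real.exp (2 * s) * ((η₁ - η₂) ^ 2 * Real.exp (2 * g₁) + s ^ 2 * (η₁ * Real.exp g₁) ^ 2) := by ring

/-- kernel: linear bookkeeping for the bond sum (p30's kernel, copied). [folklore] -/
private theorem sum_sum_split {ι κ : Type*} [Fintype ι] [Fintype κ] (p q r : ℝ) (A C : ι → ℝ) (B D : ι → κ → ℝ) :
    ∑ z, ∑ μ, p * (q * (A z + B z μ) + r * (C z + D z μ)) =
      p * (q * ((∑ z, ∑ _μ : κ, A z) + ∑ z, ∑ μ, B z μ) + r * ((∑ z, ∑ _μ : κ, C z) + ∑ z, ∑ μ, D z μ)) := by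
  simp only [mul_add, Finset.mul_sum, Finset.sum_add_distrib]

/-- kernel: linear bookkeeping for the block sum (p30's kernel, copied). [folklore] -/
private theorem sum_split {ι : Type*} [Fintype ι] (p p' q r : ℝ) (A C : ι → ℝ) :
    ∑ x, p * (p' * (q * A x + r * C x)) = p * p' * (q * ∑ x, A x + r * ∑ x, C x) := by
  simp only [mul_add, Finset.mul_sum, Finset.sum_add_distrib, mul_assoc]

/-- kernel: the per-bond estimate of the Agmon bound (`ω = ηe^{g}`): the oscillation of `ω` over a bond, split symmetrically between its two
ends, costs `e^{2t}ℓ⁻²` on the transition set `S` plus `e^{2t}(t/L^k)²ω²` (p30's kernel, copied).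
[cite: BalabanImbrieJaffe1985, (4.6.3) p.313, (7.3.1) p.326] -/
private theorem agmon_bond_le {k : ℕ} (φ : FineSp P j) (ω η g : Balaban1983to89.Site P j → ℝ) (hω : ∀ x, ω x = η x * Real.exp (g x))
    {ℓ t : ℝ} (hℓ : 0 < ℓ) (ht : 0 ≤ t) (hηL : ∀ x x', |η x - η x'| ≤ (supDist x x' : ℝ) / ℓ)
    (hg : ∀ x x', |g x - g x'| ≤ t * (supDist x x' : ℝ) / (P.L : ℝ) ^ k)
    (S : Finset (Balaban1983to89.Site P j)) (hS : ∀ x x', supDist x x' ≤ P.L ^ k → η x ≠ η x' → x ∈ S)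
    (z : Balaban1983to89.Site P j) (μ : Fin P.d) :
    (ω (z.shift μ) - ω z) ^ 2 * (‖φ (z.shift μ)‖ * ‖φ z‖) ≤
      Real.exp (2 * t) * (ℓ⁻¹ ^ 2 * ((if z ∈ S then Real.exp (2 * g z) * ‖φ z‖ ^ 2 else 0) +
          (if z.shift μ ∈ S then Real.exp (2 * g (z.shift μ)) * ‖φ (z.shift μ)‖ ^ 2 else 0)) +
        (t / (P.L : ℝ) ^ k) ^ 2 * (ω z ^ 2 * ‖φ z‖ ^ 2 + ω (z.shift μ) ^ 2 * ‖φ (z.shift μ)‖ ^ 2)) := by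
  set n : ℝ := (P.L : ℝ) ^ k with hndef
  set E : ℝ := Real.exp (2 * t) with hEdef
  have hn : 0 < n := pow_pos P.cast_L_pos _
  have hn1 : 1 ≤ n := one_le_pow₀ (by exact_mod_cast P.L_pos)
  have htn : t / n ≤ t := div_le_self ht hn1
  have hEn : Real.exp (2 * (t / n)) ≤ E := Real.exp_le_exp.2 (by linarith)
  have hL1 : 1 ≤ P.L ^ k := Nat.one_le_pow _ _ P.L_pos
  have hd1 : supDist z (z.shift μ) ≤ 1 := BIJ85TorusTentCutoff.supDist_shift_le_one' z μ
  have hgb : |g z - g (z.shift μ)| ≤ t / n := by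
    refine (hg z (z.shift μ)).trans (div_le_div_of_nonneg_right ?_ hn.le)
    have : (supDist z (z.shift μ) : ℝ) ≤ 1 := by exact_mod_cast hd1
    exact mul_le_of_le_one_right ht this
  have hgb' : |g (z.shift μ) - g z| ≤ t / n := by rwa [abs_sub_comm]
  have o1 := osc_weight_sq_le (η z) (η (z.shift μ)) hgb
  have o2 := osc_weight_sq_le (η (z.shift μ)) (η z) hgb'
  rw [← hω z, ← hω (z.shift μ)] at o1 o2
  have hI : ∀ w : Balaban1983to89.Site P j, (0 : ℝ) ≤ (if w ∈ S then (1 : ℝ) else 0) ∧ (if w ∈ S then (1 : ℝ) else 0) ≤ 1 :=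
    fun w => by constructor <;> split_ifs <;> norm_num
  have hΔ : (η z - η (z.shift μ)) ^ 2 ≤ ℓ⁻¹ ^ 2 * (if z ∈ S then 1 else 0) * (if z.shift μ ∈ S then 1 else 0) := by
    by_cases hne : η z = η (z.shift μ)
    · rw [hne, sub_self, zero_pow two_ne_zero]
      exact mul_nonneg (mul_nonneg (sq_nonneg _) (hI z).1) (hI _).1
    · have h1 : z ∈ S := hS z (z.shift μ) (hd1.trans hL1) hne
      have h2 : z.shift μ ∈ S := hS (z.shift μ) z (by rw [supDist_comm]; exact hd1.trans hL1) (Ne.symm hne)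
      rw [if_pos h1, if_pos h2, mul_one, mul_one]
      have h3 : |η z - η (z.shift μ)| ≤ ℓ⁻¹ := (hηL z (z.shift μ)).trans (by
        rw [div_le_iff₀ hℓ, inv_mul_cancel₀ hℓ.ne']; exact_mod_cast hd1)
      calc (η z - η (z.shift μ)) ^ 2 = |η z - η (z.shift μ)| ^ 2 := (sq_abs _).symm
        _ ≤ ℓ⁻¹ ^ 2 := pow_le_pow_left₀ (abs_nonneg _) h3 2
  have hΔz : (η z - η (z.shift μ)) ^ 2 ≤ ℓ⁻¹ ^ 2 * (if z ∈ S then 1 else 0) :=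
    hΔ.trans (mul_le_of_le_one_right (mul_nonneg (sq_nonneg _) (hI z).1) (hI _).2)
  have hΔz' : (η (z.shift μ) - η z) ^ 2 ≤ ℓ⁻¹ ^ 2 * (if z.shift μ ∈ S then 1 else 0) := by
    rw [show (η (z.shift μ) - η z) ^ 2 = (η z - η (z.shift μ)) ^ 2 by ring]
    refine hΔ.trans ?_
    rw [mul_assoc, mul_comm (if z ∈ S then (1:ℝ) else 0), ← mul_assoc]
    exact mul_le_of_le_one_right (mul_nonneg (sq_nonneg _) (hI _).1) (hI z).2
  have hsplit : (ω (z.shift μ) - ω z) ^ 2 * (‖φ (z.shift μ)‖ * ‖φ z‖) ≤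
      (1 / 2) * ‖φ z‖ ^ 2 * (ω z - ω (z.shift μ)) ^ 2 + (1 / 2) * ‖φ (z.shift μ)‖ ^ 2 * (ω (z.shift μ) - ω z) ^ 2 := by
    have e : (ω z - ω (z.shift μ)) ^ 2 = (ω (z.shift μ) - ω z) ^ 2 := by ring
    rw [e]
    have hp := mul_le_half_sq_add ‖φ (z.shift μ)‖ ‖φ z‖
    have h := mul_le_mul_of_nonneg_left hp (sq_nonneg (ω (z.shift μ) - ω z))
    refine h.trans (le_of_eq ?_); ring
  refine hsplit.trans ?_
  have h1 : (ω z - ω (z.shift μ)) ^ 2 ≤ 2 * E * (ℓ⁻¹ ^ 2 * (if z ∈ S then 1 else 0) * Real.exp (2 * g z) + (t / n) ^ 2 * ω z ^ 2) := by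
    refine o1.trans ?_
    have hi : (η z - η (z.shift μ)) ^ 2 * Real.exp (2 * g z) ≤ ℓ⁻¹ ^ 2 * (if z ∈ S then 1 else 0) * Real.exp (2 * g z) :=
      mul_le_mul_of_nonneg_right hΔz (Real.exp_pos _).le
    have hA : 0 ≤ ℓ⁻¹ ^ 2 * (if z ∈ S then 1 else 0) * Real.exp (2 * g z) + (t / n) ^ 2 * ω z ^ 2 :=
      add_nonneg (mul_nonneg (mul_nonneg (sq_nonneg _) (hI z).1) (Real.exp_pos _).le) (mul_nonneg (sq_nonneg _) (sq_nonneg _))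
    exact mul_le_mul (mul_le_mul_of_nonneg_left hEn zero_le_two) (add_le_add hi le_rfl) (by positivity) (by positivity)
  have h2 : (ω (z.shift μ) - ω z) ^ 2 ≤
      2 * E * (ℓ⁻¹ ^ 2 * (if z.shift μ ∈ S then 1 else 0) * Real.exp (2 * g (z.shift μ)) + (t / n) ^ 2 * ω (z.shift μ) ^ 2) := by
    refine o2.trans ?_
    have hi : (η (z.shift μ) - η z) ^ 2 * Real.exp (2 * g (z.shift μ)) ≤
        ℓ⁻¹ ^ 2 * (if z.shift μ ∈ S then 1 else 0) * Real.exp (2 * g (z.shift μ)) :=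
      mul_le_mul_of_nonneg_right hΔz' (Real.exp_pos _).le
    exact mul_le_mul (mul_le_mul_of_nonneg_left hEn zero_le_two) (add_le_add hi le_rfl) (by positivity) (by positivity)
  have half1 : (1 / 2) * ‖φ z‖ ^ 2 * (ω z - ω (z.shift μ)) ^ 2 ≤
      E * (ℓ⁻¹ ^ 2 * (if z ∈ S then Real.exp (2 * g z) * ‖φ z‖ ^ 2 else 0) + (t / n) ^ 2 * (ω z ^ 2 * ‖φ z‖ ^ 2)) := by
    have h3 := mul_le_mul_of_nonneg_left h1 (by positivity : (0 : ℝ) ≤ (1 / 2) * ‖φ z‖ ^ 2)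
    refine h3.trans (le_of_eq ?_)
    by_cases hzS : z ∈ S
    · simp only [if_pos hzS]; ring
    · simp only [if_neg hzS]; ring
  have half2 : (1 / 2) * ‖φ (z.shift μ)‖ ^ 2 * (ω (z.shift μ) - ω z) ^ 2 ≤
      E * (ℓ⁻¹ ^ 2 * (if z.shift μ ∈ S then Real.exp (2 * g (z.shift μ)) * ‖φ (z.shift μ)‖ ^ 2 else 0) +
        (t / n) ^ 2 * (ω (z.shift μ) ^ 2 * ‖φ (z.shift μ)‖ ^ 2)) := by
    have h3 := mul_le_mul_of_nonneg_left h2 (by positivity : (0 : ℝ) ≤ (1 / 2) * ‖φ (z.shift μ)‖ ^ 2)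
    refine h3.trans (le_of_eq ?_)
    by_cases hzS : z.shift μ ∈ S
    · simp only [if_pos hzS]; ring
    · simp only [if_neg hzS]; ring
  have e : E * (ℓ⁻¹ ^ 2 * ((if z ∈ S then Real.exp (2 * g z) * ‖φ z‖ ^ 2 else 0) +
          (if z.shift μ ∈ S then Real.exp (2 * g (z.shift μ)) * ‖φ (z.shift μ)‖ ^ 2 else 0)) +
        (t / n) ^ 2 * (ω z ^ 2 * ‖φ z‖ ^ 2 + ω (z.shift μ) ^ 2 * ‖φ (z.shift μ)‖ ^ 2)) =
      E * (ℓ⁻¹ ^ 2 * (if z ∈ S then Real.exp (2 * g z) * ‖φ z‖ ^ 2 else 0) + (t / n) ^ 2 * (ω z ^ 2 * ‖φ z‖ ^ 2)) +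
      E * (ℓ⁻¹ ^ 2 * (if z.shift μ ∈ S then Real.exp (2 * g (z.shift μ)) * ‖φ (z.shift μ)‖ ^ 2 else 0) +
        (t / n) ^ 2 * (ω (z.shift μ) ^ 2 * ‖φ (z.shift μ)‖ ^ 2)) := by ring
  rw [e]; exact add_le_add half1 half2

/-- kernel: the per-block estimate of the Agmon bound (`ω = ηe^{g}`, `N = L^{kd}`, `n = L^k`): the symmetrised oscillation of `ω` over a
`k`-block costs `N·2e^{2t}(ℓ⁻²n²·[x ∈ S]e^{2g} + t²ω²)‖φ‖²` per site (p30's kernel, copied). [cite: BalabanImbrieJaffe1985, (4.6.1) p.313, (7.3.1) p.326] -/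
private theorem agmon_block_le {k : ℕ} (hk : j + k ≤ P.m + P.K) (φ : FineSp P j) (ω η g : Balaban1983to89.Site P j → ℝ)
    (hω : ∀ x, ω x = η x * Real.exp (g x)) {ℓ t : ℝ} (hℓ : 0 < ℓ) (ht : 0 ≤ t)
    (hηL : ∀ x x', |η x - η x'| ≤ (supDist x x' : ℝ) / ℓ) (hg : ∀ x x', |g x - g x'| ≤ t * (supDist x x' : ℝ) / (P.L : ℝ) ^ k)
    (S : Finset (Balaban1983to89.Site P j)) (hS : ∀ x x', supDist x x' ≤ P.L ^ k → η x ≠ η x' → x ∈ S)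
    (y : Balaban1983to89.Site P (j + k)) :
    ∑ x ∈ blockK k y, ∑ x' ∈ blockK k y, (ω x - ω x') ^ 2 * (‖φ x‖ * ‖φ x'‖) ≤
      ∑ x ∈ blockK k y, (P.L : ℝ) ^ (k * P.d) * (2 * Real.exp (2 * t) *
        (ℓ⁻¹ ^ 2 * ((P.L : ℝ) ^ k) ^ 2 * (if x ∈ S then Real.exp (2 * g x) * ‖φ x‖ ^ 2 else 0) + t ^ 2 * (ω x ^ 2 * ‖φ x‖ ^ 2))) := by
  set n : ℝ := (P.L : ℝ) ^ k with hndef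
  set E : ℝ := Real.exp (2 * t) with hEdef
  have hn : 0 < n := pow_pos P.cast_L_pos _
  refine (double_sum_mul_le_sq _ (fun x x' => (ω x - ω x') ^ 2) (fun x x' => by ring) (fun x x' => sq_nonneg _) _).trans ?_
  refine Finset.sum_le_sum fun x hx => ?_
  have hterm : ∀ x' ∈ blockK k y, (ω x - ω x') ^ 2 * ‖φ x‖ ^ 2 ≤
      2 * E * (ℓ⁻¹ ^ 2 * n ^ 2 * (if x ∈ S then Real.exp (2 * g x) * ‖φ x‖ ^ 2 else 0) + t ^ 2 * (ω x ^ 2 * ‖φ x‖ ^ 2)) := by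
    intro x' hx'
    have hd : supDist x x' ≤ P.L ^ k := supDist_le_of_mem_blockK hk hx hx'
    have hgs : |g x - g x'| ≤ t := by
      refine (hg x x').trans ?_
      rw [div_le_iff₀ hn]; have : (supDist x x' : ℝ) ≤ n := by rw [hndef]; exact_mod_cast hd
      exact mul_le_mul_of_nonneg_left this ht
    have o := osc_weight_sq_le (η x) (η x') hgs
    rw [← hω x, ← hω x'] at o
    have hI : (0 : ℝ) ≤ (if x ∈ S then (1 : ℝ) else 0) := by split_ifs <;> norm_num
    have hΔ : (η x - η x') ^ 2 ≤ ℓ⁻¹ ^ 2 * n ^ 2 * (if x ∈ S then 1 else 0) := by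
      by_cases hne : η x = η x'
      · rw [hne, sub_self, zero_pow two_ne_zero]; exact mul_nonneg (by positivity) hI
      · rw [if_pos (hS x x' hd hne), mul_one]
        have h3 : |η x - η x'| ≤ ℓ⁻¹ * n := (hηL x x').trans (by
          rw [div_eq_inv_mul]; refine mul_le_mul_of_nonneg_left ?_ (inv_nonneg.2 hℓ.le)
          rw [hndef]; exact_mod_cast hd)
        calc (η x - η x') ^ 2 = |η x - η x'| ^ 2 := (sq_abs _).symm
          _ ≤ (ℓ⁻¹ * n) ^ 2 := pow_le_pow_left₀ (abs_nonneg _) h3 2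
          _ = ℓ⁻¹ ^ 2 * n ^ 2 := by ring
    have hη2 : (η x - η x') ^ 2 * Real.exp (2 * g x) ≤ ℓ⁻¹ ^ 2 * n ^ 2 * (if x ∈ S then 1 else 0) * Real.exp (2 * g x) :=
      mul_le_mul_of_nonneg_right hΔ (Real.exp_pos _).le
    have h1 : (ω x - ω x') ^ 2 ≤ 2 * E * (ℓ⁻¹ ^ 2 * n ^ 2 * (if x ∈ S then 1 else 0) * Real.exp (2 * g x) + t ^ 2 * ω x ^ 2) :=
      o.trans (mul_le_mul_of_nonneg_left (add_le_add hη2 le_rfl) (by positivity))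
    have h3 := mul_le_mul_of_nonneg_right h1 (sq_nonneg ‖φ x‖)
    refine h3.trans (le_of_eq ?_)
    by_cases hxS : x ∈ S
    · simp only [if_pos hxS]; ring
    · simp only [if_neg hxS]; ring
  calc ∑ x' ∈ blockK k y, (ω x - ω x') ^ 2 * ‖φ x‖ ^ 2
      ≤ ∑ _x' ∈ blockK k y, (2 * E * (ℓ⁻¹ ^ 2 * n ^ 2 * (if x ∈ S then Real.exp (2 * g x) * ‖φ x‖ ^ 2 else 0) +
          t ^ 2 * (ω x ^ 2 * ‖φ x‖ ^ 2))) := Finset.sum_le_sum hterm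
    _ = _ := by rw [Finset.sum_const, card_blockK k hk y, nsmul_eq_mul, Nat.cast_pow]

/-- **THE CACCIOPPOLI–AGMON `ℓ²` BOUND FOR LOCALLY `T`-HARMONIC FUNCTIONS, WITH THE COERCIVITY OF THE WEIGHTED FIELD AS A HYPOTHESIS**
(`T = D_u^*D_u + aQ_k(u)^*Q_k(u)`, `a ≥ 0`, any real `c`, `j + k ≤ m + K`, EVERY `U(1)` field — no plaquette hypothesis).  Data as in p30's
`agmon_harmonic`: a cutoff `η`, `|η(x) − η(x′)| ≤ |x − x′|_∞/ℓ`, a tilt `g`, `|g(x) − g(x′)| ≤ t|x − x′|_∞/L^k` (`t ≥ 0`), a finite set `S` containing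
every site at which `η` is not locally constant at the block scale, `(Tφ)(x) = 0` wherever `η(x) ≠ 0`, and, with `ω = ηe^{g}`, the COERCIVITY
`m‖ωφ‖² ≤ ⟨ωφ, T(ωφ)⟩` (hypothesis; in p30's file it is `coercive_opT` under global plaquette smallness, here it will be the region coercivity
of §2).  If `(2dc²(t/L^k)² + aN⁻¹t²)e^{2t} ≤ m/2` then `(m/2)·Σ_xω(x)²‖φ(x)‖² ≤ e^{2t}ℓ⁻²(2dc² + aN⁻¹n²)·Σ_{x∈S}e^{2g(x)}‖φ(x)‖²` — p30's proof
VERBATIM with `coercive_wmul_le_of_harmonic` replaced by the hypothesis composed with `energy_wmul_le_of_harmonic`.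
[cite: BalabanImbrieJaffe1985, (4.6.2) p.313, (7.3.2) p.326] [cite: Balaban1983RegularityDecay, Theorem p.573 (1.11)–(1.12)] -/
theorem agmon_harmonic_of_coercive {k : ℕ} (hk : j + k ≤ P.m + P.K) (c : ℝ) {a : ℝ} (ha : 0 ≤ a) (U : GaugeField P j U1) (φ : FineSp P j)
    (η g : Balaban1983to89.Site P j → ℝ) {ℓ t : ℝ} (hℓ : 0 < ℓ) (ht : 0 ≤ t)
    (hηL : ∀ x x', |η x - η x'| ≤ (supDist x x' : ℝ) / ℓ)
    (hg : ∀ x x', |g x - g x'| ≤ t * (supDist x x' : ℝ) / (P.L : ℝ) ^ k)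
    (S : Finset (Balaban1983to89.Site P j)) (hS : ∀ x x', supDist x x' ≤ P.L ^ k → η x ≠ η x' → x ∈ S)
    (hT : ∀ x, η x ≠ 0 → opT (Dlin c U) (QlinK U k) a φ x = 0) {m : ℝ}
    (hcoer : m * ‖wmul (fun x => η x * Real.exp (g x)) φ‖ ^ 2 ≤
      ⟪wmul (fun x => η x * Real.exp (g x)) φ, opT (Dlin c U) (QlinK U k) a (wmul (fun x => η x * Real.exp (g x)) φ)⟫)
    (hκ : (2 * P.d * c ^ 2 * (t / (P.L : ℝ) ^ k) ^ 2 + a * ((P.L : ℝ) ^ (k * P.d))⁻¹ * t ^ 2) * Real.exp (2 * t) ≤ m / 2) :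
    m / 2 * ∑ x : Balaban1983to89.Site P j, (η x * Real.exp (g x)) ^ 2 * ‖φ x‖ ^ 2
      ≤ Real.exp (2 * t) * ℓ⁻¹ ^ 2 * (2 * P.d * c ^ 2 + a * ((P.L : ℝ) ^ (k * P.d))⁻¹ * ((P.L : ℝ) ^ k) ^ 2) *
          ∑ x ∈ S, Real.exp (2 * g x) * ‖φ x‖ ^ 2 := by
  set ω : Balaban1983to89.Site P j → ℝ := fun x => η x * Real.exp (g x) with hωdef
  have hω : ∀ x, ω x = η x * Real.exp (g x) := fun x => by rw [hωdef]
  set n : ℝ := (P.L : ℝ) ^ k with hndef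
  set N : ℝ := (P.L : ℝ) ^ (k * P.d) with hNdef
  set E : ℝ := Real.exp (2 * t) with hEdef
  set WS : ℝ := ∑ x ∈ S, Real.exp (2 * g x) * ‖φ x‖ ^ 2 with hWSdef
  have hW' : ∑ x : Balaban1983to89.Site P j, (η x * Real.exp (g x)) ^ 2 * ‖φ x‖ ^ 2 = ∑ x, ω x ^ 2 * ‖φ x‖ ^ 2 :=
    Finset.sum_congr rfl fun x _ => by rw [hω]
  rw [hW']
  set W : ℝ := ∑ x : Balaban1983to89.Site P j, ω x ^ 2 * ‖φ x‖ ^ 2 with hWdef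
  have hN : 0 < N := pow_pos P.cast_L_pos _
  -- harmonic hypothesis for `ω`; p30's IMS bound composed with the coercivity hypothesis
  have hT' : ∀ x, ω x ≠ 0 → opT (Dlin c U) (QlinK U k) a φ x = 0 := fun x hx => hT x fun h => hx (by rw [hω, h, zero_mul])
  have hWeq : ‖wmul ω φ‖ ^ 2 = W := by rw [norm_wmul_sq]; exact Finset.sum_congr rfl fun x _ => by ring
  have hmain : m * W ≤ c ^ 2 * ∑ b : PBond P j, (ω b.tgt - ω b.src) ^ 2 * (‖φ b.tgt‖ * ‖φ b.src‖)
        + a * ((1 / 2) * (((P.L : ℝ) ^ (k * P.d))⁻¹) ^ 2 *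
          ∑ y : Balaban1983to89.Site P (j + k), ∑ x ∈ blockK k y, ∑ x' ∈ blockK k y, (ω x - ω x') ^ 2 * (‖φ x‖ * ‖φ x'‖)) := by
    have h1 := hcoer
    rw [inner_opT, hWeq] at h1
    exact h1.trans (energy_wmul_le_of_harmonic c ha U ω φ hT')
  -- (1) the bond defect
  have hD : c ^ 2 * ∑ b : PBond P j, (ω b.tgt - ω b.src) ^ 2 * (‖φ b.tgt‖ * ‖φ b.src‖) ≤
      c ^ 2 * (2 * E * (ℓ⁻¹ ^ 2 * (P.d * WS) + (t / n) ^ 2 * (P.d * W))) := by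
    refine mul_le_mul_of_nonneg_left ?_ (sq_nonneg _)
    rw [sum_bond_eq]
    calc ∑ z, ∑ μ : Fin P.d, (ω (PBond.tgt ⟨z, μ⟩) - ω (PBond.src ⟨z, μ⟩)) ^ 2 * (‖φ (PBond.tgt ⟨z, μ⟩)‖ * ‖φ (PBond.src ⟨z, μ⟩)‖)
        ≤ ∑ z, ∑ μ : Fin P.d, (E * (ℓ⁻¹ ^ 2 * ((if z ∈ S then Real.exp (2 * g z) * ‖φ z‖ ^ 2 else 0) +
              (if z.shift μ ∈ S then Real.exp (2 * g (z.shift μ)) * ‖φ (z.shift μ)‖ ^ 2 else 0)) +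
            (t / n) ^ 2 * (ω z ^ 2 * ‖φ z‖ ^ 2 + ω (z.shift μ) ^ 2 * ‖φ (z.shift μ)‖ ^ 2))) :=
          Finset.sum_le_sum fun z _ => Finset.sum_le_sum fun μ _ => agmon_bond_le φ ω η g hω hℓ ht hηL hg S hS z μ
      _ = E * (ℓ⁻¹ ^ 2 * (P.d * WS + P.d * WS) + (t / n) ^ 2 * (P.d * W + P.d * W)) := by
          rw [sum_sum_split E (ℓ⁻¹ ^ 2) ((t / n) ^ 2) (fun z => if z ∈ S then Real.exp (2 * g z) * ‖φ z‖ ^ 2 else 0)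
            (fun z => ω z ^ 2 * ‖φ z‖ ^ 2) (fun z μ => if z.shift μ ∈ S then Real.exp (2 * g (z.shift μ)) * ‖φ (z.shift μ)‖ ^ 2 else 0)
            (fun z μ => ω (z.shift μ) ^ 2 * ‖φ (z.shift μ)‖ ^ 2), hWSdef, hWdef,
            sum_sum_indicator S (fun x => Real.exp (2 * g x) * ‖φ x‖ ^ 2),
            sum_sum_shift_indicator S (fun x => Real.exp (2 * g x) * ‖φ x‖ ^ 2),
            sum_sum_dir (fun x => ω x ^ 2 * ‖φ x‖ ^ 2), sum_sum_shift_dir (fun x => ω x ^ 2 * ‖φ x‖ ^ 2)]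
      _ = 2 * E * (ℓ⁻¹ ^ 2 * (P.d * WS) + (t / n) ^ 2 * (P.d * W)) := by ring
  -- (2) the block defect
  have hQ : (1 / 2) * (N⁻¹) ^ 2 *
        ∑ y : Balaban1983to89.Site P (j + k), ∑ x ∈ blockK k y, ∑ x' ∈ blockK k y, (ω x - ω x') ^ 2 * (‖φ x‖ * ‖φ x'‖) ≤
      N⁻¹ * E * (ℓ⁻¹ ^ 2 * n ^ 2 * WS + t ^ 2 * W) := by
    calc (1 / 2) * (N⁻¹) ^ 2 *
          ∑ y : Balaban1983to89.Site P (j + k), ∑ x ∈ blockK k y, ∑ x' ∈ blockK k y, (ω x - ω x') ^ 2 * (‖φ x‖ * ‖φ x'‖)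
        ≤ (1 / 2) * (N⁻¹) ^ 2 * ∑ y : Balaban1983to89.Site P (j + k), ∑ x ∈ blockK k y,
            N * (2 * E * (ℓ⁻¹ ^ 2 * n ^ 2 * (if x ∈ S then Real.exp (2 * g x) * ‖φ x‖ ^ 2 else 0) + t ^ 2 * (ω x ^ 2 * ‖φ x‖ ^ 2))) :=
          mul_le_mul_of_nonneg_left (Finset.sum_le_sum fun y _ => agmon_block_le hk φ ω η g hω hℓ ht hηL hg S hS y) (by positivity)
      _ = N⁻¹ * E * (ℓ⁻¹ ^ 2 * n ^ 2 * WS + t ^ 2 * W) := by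
          rw [sum_blockK_eq_sum (fun x => N * (2 * E * (ℓ⁻¹ ^ 2 * n ^ 2 * (if x ∈ S then Real.exp (2 * g x) * ‖φ x‖ ^ 2 else 0) +
            t ^ 2 * (ω x ^ 2 * ‖φ x‖ ^ 2)))), hWSdef, hWdef,
            sum_split N (2 * E) (ℓ⁻¹ ^ 2 * n ^ 2) (t ^ 2) (fun x => if x ∈ S then Real.exp (2 * g x) * ‖φ x‖ ^ 2 else 0)
              (fun x => ω x ^ 2 * ‖φ x‖ ^ 2), ← Finset.sum_filter, Finset.filter_mem_eq_inter, Finset.univ_inter]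
          have hN0 : N ≠ 0 := hN.ne'
          field_simp
  -- assemble: `mW ≤ c²·(…) + a·(…)`, absorb the `W`-terms with `hκ`
  have hfinal : m * W ≤ (2 * P.d * c ^ 2 * (t / n) ^ 2 + a * N⁻¹ * t ^ 2) * E * W +
      E * ℓ⁻¹ ^ 2 * (2 * P.d * c ^ 2 + a * N⁻¹ * n ^ 2) * WS := by
    have h := hmain.trans (add_le_add hD (mul_le_mul_of_nonneg_left hQ ha))
    have e : c ^ 2 * (2 * E * (ℓ⁻¹ ^ 2 * (P.d * WS) + (t / n) ^ 2 * (P.d * W))) + a * (N⁻¹ * E * (ℓ⁻¹ ^ 2 * n ^ 2 * WS + t ^ 2 * W)) =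
        (2 * P.d * c ^ 2 * (t / n) ^ 2 + a * N⁻¹ * t ^ 2) * E * W + E * ℓ⁻¹ ^ 2 * (2 * P.d * c ^ 2 + a * N⁻¹ * n ^ 2) * WS := by ring
    linarith [h, e]
  have hW0 : 0 ≤ W := Finset.sum_nonneg fun x _ => by positivity
  have hκ' : (2 * P.d * c ^ 2 * (t / n) ^ 2 + a * N⁻¹ * t ^ 2) * E * W ≤ m / 2 * W := mul_le_mul_of_nonneg_right hκ hW0
  have : m / 2 * W ≤ E * ℓ⁻¹ ^ 2 * (2 * P.d * c ^ 2 + a * N⁻¹ * n ^ 2) * WS := by linarith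
  exact this

end Agmon

/-! ## §2 Coercivity of the TORUS form on fields supported in a `k`-block union, from the blocks of the union alone; the k-uniform Agmon step -/

section Coercive

open BIJ88NeumannPropagatorSmallFieldRegion (coercive_region_poincare)
open BIJ85Ineq732PullBack (norm_Dlin_sq')
open BIJ85Ineq732General (norm_QlinK_sq)
open BIJ85Ineq732Flat (sum_norm_sq_eq)

/-- **COERCIVITY OF THE TORUS FORM `‖D_uχ‖² + a‖Q_k(u)χ‖²` ON FIELDS SUPPORTED IN A `k`-BLOCK UNION `X`, FROM THE BLOCKS OF `X` ALONE**: for a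
union `X` of `k`-blocks, a `U(1)` field `u` with `|u_b − 1| ≤ T` on the bonds of `X*` with both ends in one `k`-block and `|u(Γ^{(k)}_{y_k,y}) − 1| ≤ δ`
on `X`, `2(n−1)n·d·T² + 2δ² ≤ 1/2` (`n = L^k`, `N = L^{kd}`), `a ≥ 0`, and EVERY `χ` vanishing off `X`:
`min(c²/(4n²), a/(4N))·‖χ‖² ≤ ⟨χ, (D_u^*D_u + aQ_k(u)^*Q_k(u))χ⟩` — p34 gen 16's region Poincaré inequality `coercive_region_poincare` (the
`k`-block Poincaré inequality of the blocks of `X` only, [I] p. 326 *"by change of gauge … in a local region"*), the Neumann sums over `X*` and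
over the blocks of `X` being dominated by the torus sums.  Nothing is assumed about `u` away from `X`. [cite: BalabanImbrieJaffe1985, (7.3.2) p.326, (4.6.2) p.313] -/
theorem coercive_univ_of_region {k : ℕ} (hk : j + k ≤ P.m + P.K) {X : Finset (Balaban1983to89.Site P j)} (hX : IsBlockUnion k X)
    (U : GaugeField P j U1) {T δ : ℝ}
    (hInt : ∀ b ∈ starB X, blkIter k b.src = blkIter k b.tgt → ‖toC (U b) - 1‖ ≤ T)
    (hTree : ∀ x ∈ X, ‖holCK U k x - 1‖ ≤ δ)
    (hsmall : 2 * (((P.L : ℝ) ^ k - 1) * (P.L : ℝ) ^ k) * P.d * T ^ 2 + 2 * δ ^ 2 ≤ 1 / 2)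
    (c : ℝ) {a : ℝ} (ha : 0 ≤ a) (χ : FineSp P j) (hχ : ∀ x, x ∉ X → χ x = 0) :
    min (c ^ 2 / (4 * ((P.L : ℝ) ^ k) ^ 2)) (a / (4 * (P.L : ℝ) ^ (k * P.d))) * ‖χ‖ ^ 2
      ≤ ⟪χ, opT (Dlin c U) (QlinK U k) a χ⟫ := by
  rw [inner_opT, norm_Dlin_sq', norm_QlinK_sq, ← sum_norm_sq_eq χ]
  have hP := coercive_region_poincare hk hX U hInt hTree (WithLp.ofLp χ) hχ
  set Ssum : ℝ := ∑ x : Balaban1983to89.Site P j, ‖χ x‖ ^ 2 with hSsum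
  set EX : ℝ := ∑ b ∈ starB X, ‖toC (U b) * χ b.tgt - χ b.src‖ ^ 2 with hEX
  set E : ℝ := ∑ b : PBond P j, ‖toC (U b) * χ b.tgt - χ b.src‖ ^ 2 with hE
  set QX : ℝ := ∑ y ∈ innerK k X, ‖qCovK U k (WithLp.ofLp χ) y‖ ^ 2 with hQX
  set Qn : ℝ := ∑ y : Balaban1983to89.Site P (j + k), ‖qCovK U k (WithLp.ofLp χ) y‖ ^ 2 with hQn
  have hn : 0 < ((P.L : ℝ) ^ k) ^ 2 := pow_pos (pow_pos P.cast_L_pos _) _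
  have hLk : (P.L : ℝ) ^ k ≠ 0 := (pow_pos P.cast_L_pos _).ne'
  have hN : 0 < (P.L : ℝ) ^ (k * P.d) := pow_pos P.cast_L_pos _
  have hS0 : 0 ≤ Ssum := sum_nonneg fun _ _ => sq_nonneg _
  have hE0 : 0 ≤ E := sum_nonneg fun _ _ => sq_nonneg _
  have hQ0 : 0 ≤ Qn := sum_nonneg fun _ _ => sq_nonneg _
  have hEXE : EX ≤ E := Finset.sum_le_univ_sum_of_nonneg fun _ => sq_nonneg _
  have hQXQ : QX ≤ Qn := Finset.sum_le_univ_sum_of_nonneg fun _ => sq_nonneg _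
  -- the Poincaré inequality: `Ssum/2 ≤ 2(n−1)n·EX + 2N·QX ≤ 2n²·E + 2N·Qn`
  have h1 : Ssum / 2 ≤ 2 * ((P.L : ℝ) ^ k) ^ 2 * E + 2 * (P.L : ℝ) ^ (k * P.d) * Qn := by
    have hC0 : 0 ≤ ((P.L : ℝ) ^ k - 1) * (P.L : ℝ) ^ k := by
      have h1 : (1 : ℝ) ≤ (P.L : ℝ) ^ k := one_le_pow₀ (B1RG242Torus.one_lt_cast_L P).le
      exact mul_nonneg (by linarith) (by linarith)
    have h2 : 2 * (((P.L : ℝ) ^ k - 1) * (P.L : ℝ) ^ k) * EX ≤ 2 * ((P.L : ℝ) ^ k) ^ 2 * E := by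
      have : ((P.L : ℝ) ^ k - 1) * (P.L : ℝ) ^ k ≤ ((P.L : ℝ) ^ k) ^ 2 := by nlinarith [pow_pos P.cast_L_pos k]
      calc 2 * (((P.L : ℝ) ^ k - 1) * (P.L : ℝ) ^ k) * EX ≤ 2 * (((P.L : ℝ) ^ k - 1) * (P.L : ℝ) ^ k) * E :=
            mul_le_mul_of_nonneg_left hEXE (by positivity)
        _ ≤ 2 * ((P.L : ℝ) ^ k) ^ 2 * E := by nlinarith
    have h3 : 2 * (P.L : ℝ) ^ (k * P.d) * QX ≤ 2 * (P.L : ℝ) ^ (k * P.d) * Qn := mul_le_mul_of_nonneg_left hQXQ (by positivity)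
    have h4 : Ssum / 2 ≤ (1 - (2 * (((P.L : ℝ) ^ k - 1) * (P.L : ℝ) ^ k) * P.d * T ^ 2 + 2 * δ ^ 2)) * Ssum := by nlinarith
    linarith [hP, h2, h3, h4]
  -- `m₁·Ssum ≤ c²E + aQn`
  set m₁ := min (c ^ 2 / (4 * ((P.L : ℝ) ^ k) ^ 2)) (a / (4 * (P.L : ℝ) ^ (k * P.d))) with hm₁
  have hmE : m₁ * (4 * ((P.L : ℝ) ^ k) ^ 2 * E) ≤ c ^ 2 * E := by
    have hle := min_le_left (c ^ 2 / (4 * ((P.L : ℝ) ^ k) ^ 2)) (a / (4 * (P.L : ℝ) ^ (k * P.d)))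
    calc m₁ * (4 * ((P.L : ℝ) ^ k) ^ 2 * E) ≤ (c ^ 2 / (4 * ((P.L : ℝ) ^ k) ^ 2)) * (4 * ((P.L : ℝ) ^ k) ^ 2 * E) :=
          mul_le_mul_of_nonneg_right hle (by positivity)
      _ = c ^ 2 * E := by field_simp
  have hmQ : m₁ * (4 * (P.L : ℝ) ^ (k * P.d) * Qn) ≤ a * Qn := by
    have hle := min_le_right (c ^ 2 / (4 * ((P.L : ℝ) ^ k) ^ 2)) (a / (4 * (P.L : ℝ) ^ (k * P.d)))
    calc m₁ * (4 * (P.L : ℝ) ^ (k * P.d) * Qn) ≤ (a / (4 * (P.L : ℝ) ^ (k * P.d))) * (4 * (P.L : ℝ) ^ (k * P.d) * Qn) :=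
          mul_le_mul_of_nonneg_right hle (by positivity)
      _ = a * Qn := by field_simp
  have hm0 : 0 ≤ m₁ := le_min (by positivity) (by positivity)
  calc m₁ * Ssum = m₁ * (2 * (Ssum / 2)) := by ring
    _ ≤ m₁ * (2 * (2 * ((P.L : ℝ) ^ k) ^ 2 * E + 2 * (P.L : ℝ) ^ (k * P.d) * Qn)) :=
        mul_le_mul_of_nonneg_left (by linarith) hm0
    _ = m₁ * (4 * ((P.L : ℝ) ^ k) ^ 2 * E) + m₁ * (4 * (P.L : ℝ) ^ (k * P.d) * Qn) := by ring
    _ ≤ c ^ 2 * E + a * Qn := add_le_add hmE hmQ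

end Coercive

section Step

open GaugeField (gaugeAct plaqHol)
open BIJ88NeumannPropagatorSmallFieldClose (nOp_gaugeAct_mulVec_smul)
open BIJ88NeumannPropagatorSmoothNearRegion (blockGauge_of_near)
open BIJ85BiCentredAxialGauge (centredGaugeDir)

/-- kernel: `α_k·ε²·(L^k)² = a_k` (`α_k = a_k(L^kε)^{−2}`; p30's kernel, copied). [cite: Balaban1982Higgs1, (2.20) p.610] -/
private theorem alpha_mul_eps_sq (a : ℝ) (k : ℕ) :
    B1RG242Torus.α P a k * (P.eps ^ 2 * ((P.L : ℝ) ^ k) ^ 2) = B1.aSeq a P.L k := by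
  have hε : P.eps ≠ 0 := P.eps_pos.ne'
  have hL : (P.L : ℝ) ^ k ≠ 0 := pow_ne_zero _ P.cast_L_pos.ne'
  rw [B1RG242Torus.α]
  unfold Params.spacing
  field_simp

/-- **THE AGMON BOUND FOR `N(u)`-HARMONIC FUNCTIONS WITH THE CUTOFF SUPPORTED IN A `k`-BLOCK UNION `X`, UNDER THE BONDWISE SMALLNESS ON `X`
ONLY, k-UNIFORM FORM** (p30's `agmon_step` localised): for p31's whole-torus operator `N(u) = nOp (α_kL^{kd}) ε⁻¹ u k T`, a `U(1)` field with
`|u_b − 1| ≤ T` on the intra-block bonds of `X*` and `|u(Γ^{(k)}_{y_k,y}) − 1| ≤ δ` on `X`, `2(n−1)n·d·T² + 2δ² ≤ 1/2`, a `1/L^k`-Lipschitz cutoff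
`η` VANISHING OFF `X`, a `t/L^k`-Lipschitz tilt `g`, a set `S` carrying the block-scale oscillation of `η`, `ψ` with `(N(u)ψ)(y) = 0` off
`{η = 0}`, and `t²(2d + a)e^{2t} ≤ m_*/2`, `m_* = min(a(1 − L^{−2})/4, 1/4)`:
`Σ_y(η(y)e^{g(y)})²‖ψ(y)‖² ≤ (2e^{2t}(2d + a)/m_*)·Σ_{y∈S}e^{2g(y)}‖ψ(y)‖²` — §1 with the coercivity `coercive_univ_of_region` for `ω ψ`
(supported in `X`), constants of record inserted (`m₁ ≥ m_*/(ε²L^{2k})`, `a(1 − L^{−2}) < a_k ≤ a`).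
[cite: BalabanImbrieJaffe1985, (4.6.2) p.313, (7.3.2) p.326] [cite: Balaban1983RegularityDecay, Theorem p.573 (1.11)–(1.12)] -/
theorem agmon_step_region {a : ℝ} (ha : 0 < a) {k : ℕ} (hk1 : 1 ≤ k) (hk : k ≤ P.m + P.K) (U : GaugeField P 0 U1)
    {X : Finset (Balaban1983to89.Site P 0)} (hX : IsBlockUnion k X) {T δ : ℝ}
    (hInt : ∀ b ∈ starB X, blkIter k b.src = blkIter k b.tgt → ‖toC (U b) - 1‖ ≤ T)
    (hTree : ∀ x ∈ X, ‖holCK U k x - 1‖ ≤ δ)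
    (hsmall : 2 * (((P.L : ℝ) ^ k - 1) * (P.L : ℝ) ^ k) * P.d * T ^ 2 + 2 * δ ^ 2 ≤ 1 / 2)
    (ψ : Balaban1983to89.Site P 0 → ℂ) (η g : Balaban1983to89.Site P 0 → ℝ) {t : ℝ} (ht : 0 ≤ t)
    (hηX : ∀ y, η y ≠ 0 → y ∈ X)
    (hηL : ∀ y y', |η y - η y'| ≤ (supDist y y' : ℝ) / (P.L : ℝ) ^ k)
    (hg : ∀ y y', |g y - g y'| ≤ t * (supDist y y' : ℝ) / (P.L : ℝ) ^ k)
    (S : Finset (Balaban1983to89.Site P 0)) (hS : ∀ y y', supDist y y' ≤ P.L ^ k → η y ≠ η y' → y ∈ S)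
    (hT : ∀ y, η y ≠ 0 → (nOp (B1RG242Torus.α P a k * (P.L : ℝ) ^ (k * P.d)) P.eps⁻¹ U k univ *ᵥ ψ) y = 0)
    (htu : t ^ 2 * (2 * P.d + a) * Real.exp (2 * t) ≤ min (a * (1 - ((P.L : ℝ) ^ 2)⁻¹) / 4) (1 / 4) / 2) :
    ∑ y, (η y * Real.exp (g y)) ^ 2 * ‖ψ y‖ ^ 2 ≤
      (2 * Real.exp (2 * t) * (2 * P.d + a) / min (a * (1 - ((P.L : ℝ) ^ 2)⁻¹) / 4) (1 / 4)) * ∑ y ∈ S, Real.exp (2 * g y) * ‖ψ y‖ ^ 2 := by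
  have hk0 : 0 + k ≤ P.m + P.K := by omega
  have hL1 : (1 : ℝ) < P.L := B1RG242Torus.one_lt_cast_L P
  have hα : 0 < B1RG242Torus.α P a k := mul_pos (B1.aSeq_pos ha hL1 hk1) (inv_pos.2 (pow_pos (P.spacing_pos k) 2))
  have ha' : 0 < B1RG242Torus.α P a k * (P.L : ℝ) ^ (k * P.d) := mul_pos hα (pow_pos P.cast_L_pos _)
  have haS : B1.aSeq a P.L k ≤ a := B1.aSeq_le ha hL1 k hk1
  have haSlo : a * (1 - ((P.L : ℝ) ^ 2)⁻¹) < B1.aSeq a P.L k := B1.ainf_lt_aSeq ha hL1 k hk1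
  have hn0 : (0 : ℝ) < (P.L : ℝ) ^ k := pow_pos P.cast_L_pos k
  have hN0 : (0 : ℝ) < (P.L : ℝ) ^ (k * P.d) := pow_pos P.cast_L_pos _
  have hε : 0 < P.eps := P.eps_pos
  -- `m_* ≤ 1/4`, `m_* ≤ a(1−L⁻²)/4 < a_k/4`, `0 < m_*`
  set mlo : ℝ := min (a * (1 - ((P.L : ℝ) ^ 2)⁻¹) / 4) (1 / 4) with hmlo
  have hinf0 : 0 < a * (1 - ((P.L : ℝ) ^ 2)⁻¹) := by
    have : ((P.L : ℝ) ^ 2)⁻¹ < 1 := inv_lt_one_of_one_lt₀ (by nlinarith)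
    exact mul_pos ha (by linarith)
  have hmlo0 : 0 < mlo := lt_min (by linarith) (by norm_num)
  have hmlo4 : mlo ≤ 1 / 4 := min_le_right _ _
  have hmloa : mlo ≤ B1.aSeq a P.L k / 4 := (min_le_left _ _).trans (by linarith)
  set q : ℝ := P.eps ^ 2 * ((P.L : ℝ) ^ k) ^ 2 with hq
  have hq0 : 0 < q := by positivity
  have hαq : B1RG242Torus.α P a k * q = B1.aSeq a P.L k := alpha_mul_eps_sq a k
  -- the harmonic hypothesis in p11's language
  set φ : FineSp P 0 := WithLp.toLp 2 ψ with hφ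
  have hT' : ∀ y, η y ≠ 0 → opT (Dlin P.eps⁻¹ U) (QlinK U k) (B1RG242Torus.α P a k * (P.L : ℝ) ^ (k * P.d)) φ y = 0 := by
    intro y hy
    rw [BIJ88NeumannPropagatorWholeTorus.opT_eq_nLin]
    show (WithLp.ofLp (BIJ88NeumannPropagatorWholeTorus.nLin (B1RG242Torus.α P a k * (P.L : ℝ) ^ (k * P.d)) P.eps⁻¹ U k φ)) y = 0
    rw [BIJ88NeumannPropagatorWholeTorus.ofLp_nLin, hφ, WithLp.ofLp_toLp]
    exact hT y hy
  -- the coercivity constant of §2 and its lower bound `m_*/q ≤ m₁`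
  set m₁ : ℝ := min (P.eps⁻¹ ^ 2 / (4 * ((P.L : ℝ) ^ k) ^ 2))
    (B1RG242Torus.α P a k * (P.L : ℝ) ^ (k * P.d) / (4 * (P.L : ℝ) ^ (k * P.d))) with hm₁
  have hm₁lo : mlo / q ≤ m₁ := by
    refine le_min ?_ ?_
    · have h1 : mlo / q ≤ 1 / 4 / q := div_le_div_of_nonneg_right hmlo4 hq0.le
      refine h1.trans (le_of_eq ?_)
      rw [hq]; field_simp
    · have h1 : mlo / q ≤ B1.aSeq a P.L k / 4 / q := div_le_div_of_nonneg_right hmloa hq0.le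
      refine h1.trans (le_of_eq ?_)
      rw [← hαq]; field_simp
  -- the weighted field is supported in `X`: coercivity from the blocks of `X`
  have hωX : ∀ x, x ∉ X → (wmul (fun x => η x * Real.exp (g x)) φ) x = 0 := by
    intro x hx
    have hηx : η x = 0 := by by_contra h; exact hx (hηX x h)
    rw [wmul_apply, hηx, zero_mul, Complex.ofReal_zero, zero_mul]
  have hcoer := coercive_univ_of_region hk0 hX U hInt hTree hsmall P.eps⁻¹ ha'.le (wmul (fun x => η x * Real.exp (g x)) φ) hωX
  have hcoer' : m₁ * ‖wmul (fun x => η x * Real.exp (g x)) φ‖ ^ 2 ≤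
      ⟪wmul (fun x => η x * Real.exp (g x)) φ, opT (Dlin P.eps⁻¹ U) (QlinK U k) (B1RG242Torus.α P a k * (P.L : ℝ) ^ (k * P.d))
        (wmul (fun x => η x * Real.exp (g x)) φ)⟫ := by rw [hm₁]; exact hcoer
  -- the tilt condition of record
  have hκ : (2 * P.d * P.eps⁻¹ ^ 2 * (t / (P.L : ℝ) ^ k) ^ 2 +
      B1RG242Torus.α P a k * (P.L : ℝ) ^ (k * P.d) * ((P.L : ℝ) ^ (k * P.d))⁻¹ * t ^ 2) * Real.exp (2 * t) ≤ m₁ / 2 := by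
    have e : 2 * P.d * P.eps⁻¹ ^ 2 * (t / (P.L : ℝ) ^ k) ^ 2 +
        B1RG242Torus.α P a k * (P.L : ℝ) ^ (k * P.d) * ((P.L : ℝ) ^ (k * P.d))⁻¹ * t ^ 2 =
        t ^ 2 * (2 * P.d + B1.aSeq a P.L k) / q := by
      rw [← hαq, hq]; field_simp
    rw [e]
    have h1 : t ^ 2 * (2 * P.d + B1.aSeq a P.L k) / q * Real.exp (2 * t) ≤ t ^ 2 * (2 * P.d + a) * Real.exp (2 * t) / q := by
      rw [div_mul_eq_mul_div]
      refine div_le_div_of_nonneg_right (mul_le_mul_of_nonneg_right ?_ (Real.exp_pos _).le) hq0.le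
      exact mul_le_mul_of_nonneg_left (by linarith) (sq_nonneg _)
    have h2 : t ^ 2 * (2 * P.d + a) * Real.exp (2 * t) / q ≤ mlo / 2 / q := div_le_div_of_nonneg_right htu hq0.le
    have h3 : mlo / 2 / q = mlo / q / 2 := by ring
    linarith [hm₁lo]
  have hag := agmon_harmonic_of_coercive (j := 0) hk0 P.eps⁻¹ ha'.le U φ η g hn0 ht hηL hg S hS hT' hcoer' hκ
  -- read it back on `ψ`
  have hX' : ∑ y, (η y * Real.exp (g y)) ^ 2 * ‖φ y‖ ^ 2 = ∑ y, (η y * Real.exp (g y)) ^ 2 * ‖ψ y‖ ^ 2 := rfl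
  have hY : ∑ y ∈ S, Real.exp (2 * g y) * ‖φ y‖ ^ 2 = ∑ y ∈ S, Real.exp (2 * g y) * ‖ψ y‖ ^ 2 := rfl
  rw [hX', hY] at hag
  set Xs := ∑ y, (η y * Real.exp (g y)) ^ 2 * ‖ψ y‖ ^ 2 with hXdef
  set Y := ∑ y ∈ S, Real.exp (2 * g y) * ‖ψ y‖ ^ 2 with hYdef
  have hXs0 : 0 ≤ Xs := sum_nonneg fun _ _ => by positivity
  have hY0 : 0 ≤ Y := sum_nonneg fun _ _ => by positivity
  -- the defect coefficient of record
  have hcoef : Real.exp (2 * t) * ((P.L : ℝ) ^ k)⁻¹ ^ 2 *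
      (2 * P.d * P.eps⁻¹ ^ 2 + B1RG242Torus.α P a k * (P.L : ℝ) ^ (k * P.d) * ((P.L : ℝ) ^ (k * P.d))⁻¹ * ((P.L : ℝ) ^ k) ^ 2) =
      Real.exp (2 * t) * (2 * P.d + B1.aSeq a P.L k) / q := by
    rw [← hαq, hq]; field_simp
  rw [hcoef] at hag
  -- `(m_*/(2q))·X ≤ (m₁/2)·X ≤ e^{2t}(2d + a_k)/q·Y ≤ e^{2t}(2d + a)/q·Y`
  have h1 : mlo / q / 2 * Xs ≤ Real.exp (2 * t) * (2 * P.d + a) / q * Y := by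
    calc mlo / q / 2 * Xs ≤ m₁ / 2 * Xs := mul_le_mul_of_nonneg_right (by linarith [hm₁lo]) hXs0
      _ ≤ Real.exp (2 * t) * (2 * P.d + B1.aSeq a P.L k) / q * Y := hag
      _ ≤ Real.exp (2 * t) * (2 * P.d + a) / q * Y := by
          refine mul_le_mul_of_nonneg_right (div_le_div_of_nonneg_right ?_ hq0.le) hY0
          exact mul_le_mul_of_nonneg_left (by linarith) (Real.exp_pos _).le
  have h2 : mlo * Xs ≤ 2 * Real.exp (2 * t) * (2 * P.d + a) * Y := by
    have := mul_le_mul_of_nonneg_left h1 (by positivity : (0 : ℝ) ≤ 2 * q)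
    have e1 : 2 * q * (mlo / q / 2 * Xs) = mlo * Xs := by field_simp
    have e2 : 2 * q * (Real.exp (2 * t) * (2 * P.d + a) / q * Y) = 2 * Real.exp (2 * t) * (2 * P.d + a) * Y := by field_simp
    rw [e1, e2] at this; exact this
  rw [div_mul_eq_mul_div, le_div_iff₀ hmlo0]
  linarith

/-- **THE SAME UNDER PLAQUETTE SMALLNESS NEAR `X` ONLY** ([I] p. 326 *"by change of gauge u_k can be transformed in a local region Λ"*): if
`‖u(∂p) − 1‖ ≤ θ` for the plaquettes based within `2L^k` of the `k`-block union `X` (nothing assumed elsewhere), `2(L^k − 1) + 4 < |T|`,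
`T ≥ (d−1)(L^k−1)θ` with `2(L^k−1)L^k·d·T² + 2(d(L^k−1)T)² ≤ 1/2`, then the conclusion of `agmon_step_region` holds for every `N(u)`-harmonic
`ψ` (off `{η = 0}`, `η` supported in `X`) — the blockwise tree gauge `h` of gen 20's `blockGauge_of_near` delivers the bondwise hypotheses for
`u^h`, `h·ψ` is `N(u^h)`-harmonic where `ψ` is `N(u)`-harmonic (`N(u^h)(h·w) = h·N(u)w`), and `|h| = 1`.
[cite: BalabanImbrieJaffe1985, (7.3.1)–(7.3.2) p.326] [cite: BalabanImbrieJaffe1988, (2.32) p.263] -/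
theorem agmon_step_near {a : ℝ} (ha : 0 < a) {k : ℕ} (hk1 : 1 ≤ k) (hk : k ≤ P.m + P.K) (U : GaugeField P 0 U1)
    {X : Finset (Balaban1983to89.Site P 0)} (hX : IsBlockUnion k X) {θ : ℝ} (hθ : 0 ≤ θ)
    (hplaq : ∀ p : Balaban1983to89.Plaq P 0, (∃ y ∈ X, supDist y p.src ≤ 2 * P.L ^ k) → ‖toC (plaqHol U p) - 1‖ ≤ θ)
    (hR : 2 * (P.L ^ k - 1) + 4 < P.sitesPerDir 0) {T : ℝ} (hTθ : ((P.d - 1 : ℕ) : ℝ) * ((P.L : ℝ) ^ k - 1) * θ ≤ T)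
    (hsmall : 2 * (((P.L : ℝ) ^ k - 1) * (P.L : ℝ) ^ k) * P.d * T ^ 2 + 2 * (P.d * ((P.L : ℝ) ^ k - 1) * T) ^ 2 ≤ 1 / 2)
    (ψ : Balaban1983to89.Site P 0 → ℂ) (η g : Balaban1983to89.Site P 0 → ℝ) {t : ℝ} (ht : 0 ≤ t)
    (hηX : ∀ y, η y ≠ 0 → y ∈ X)
    (hηL : ∀ y y', |η y - η y'| ≤ (supDist y y' : ℝ) / (P.L : ℝ) ^ k)
    (hg : ∀ y y', |g y - g y'| ≤ t * (supDist y y' : ℝ) / (P.L : ℝ) ^ k)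
    (S : Finset (Balaban1983to89.Site P 0)) (hS : ∀ y y', supDist y y' ≤ P.L ^ k → η y ≠ η y' → y ∈ S)
    (hT : ∀ y, η y ≠ 0 → (nOp (B1RG242Torus.α P a k * (P.L : ℝ) ^ (k * P.d)) P.eps⁻¹ U k univ *ᵥ ψ) y = 0)
    (htu : t ^ 2 * (2 * P.d + a) * Real.exp (2 * t) ≤ min (a * (1 - ((P.L : ℝ) ^ 2)⁻¹) / 4) (1 / 4) / 2) :
    ∑ y, (η y * Real.exp (g y)) ^ 2 * ‖ψ y‖ ^ 2 ≤
      (2 * Real.exp (2 * t) * (2 * P.d + a) / min (a * (1 - ((P.L : ℝ) ^ 2)⁻¹) / 4) (1 / 4)) * ∑ y ∈ S, Real.exp (2 * g y) * ‖ψ y‖ ^ 2 := by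
  have hk0 : 0 + k ≤ P.m + P.K := by omega
  set i₀ : Fin P.d := ⟨0, lt_of_lt_of_le Nat.zero_lt_one P.hd⟩ with hi₀
  obtain ⟨hbond, htree⟩ := blockGauge_of_near hk0 U hθ hX hplaq hR hTθ i₀
  set h : GaugeTransf P 0 U1 := fun z => centredGaugeDir U (cornerIter k (blkIter k z)) (P.L ^ k - 1) i₀ z with hh
  set ψ' : Balaban1983to89.Site P 0 → ℂ := fun z => toC (h z) * ψ z with hψ'
  have hT' : ∀ y, η y ≠ 0 → (nOp (B1RG242Torus.α P a k * (P.L : ℝ) ^ (k * P.d)) P.eps⁻¹ (gaugeAct h U) k univ *ᵥ ψ') y = 0 := by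
    intro y hy
    rw [hψ', nOp_gaugeAct_mulVec_smul hk0]
    show toC (h y) * _ = 0
    rw [hT y hy, mul_zero]
  have hag := agmon_step_region ha hk1 hk (gaugeAct h U) hX hbond htree hsmall ψ' η g ht hηX hηL hg S hS hT' htu
  have hnorm : ∀ y, ‖ψ' y‖ = ‖ψ y‖ := fun y => by rw [hψ', norm_mul, norm_toC, one_mul]
  simp only [hnorm] at hag
  exact hag

end Step

/-! ## §3 [Balaban1983RegularityDecay] (1.11)–(1.12) AT FIELDS PLAQUETTE-SMALL NEAR `Ω` ONLY, IN THE (H1.12″) SHAPE OF p31's `opClose231_gen` -/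

section Main

open GaugeField (gaugeAct plaqHol)
open BIJ88NeumannPropagatorSmallFieldClose (nOp_univ_diff_apply_eq_zero exists_depth depth_le_add mem_of_depth_pos interior_of_depth_two
  cutoff_props tilt_lipschitz nOp_gaugeAct_mulVec_smul supDist_le_half)
open BIJ85ScalarPropagatorSupDecayDeriv (gamma_nsq_le_one)
open BIJ85TorusTentCutoff (ball mem_ball)
open BIJ85SmallFieldHarmonicMeanValue (harmonic_meanValue)
open BIJ85BiCentredAxialGauge (centredGaugeDir)
open BIJ88NeumannPropagatorSmoothNearRegion (dist1_centredGaugeDir_le_supDist_of_near plaqSmall_near_of_smoothOn)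
open BIJ88Smooth43Axial (dist1_eq_norm_toC_sub_one)
open BIJ88Sect2Statements (SmoothOn)

/-- kernel: **the exponent budget** (pure real arithmetic; p30's kernel, copied): with `δ₁ = min(t/4, δ₀/2)`, `D ≤ T + D′`, `D_f ≤ D′ + c₁`,
`D_b ≤ T + c₁`, `c₁ ≤ 4n`: `e^{−2tT/n}·(e^{−δ₀D′/n})² ≤ e^{2t+4δ₀}·(e^{−δ₁D/n}e^{−δ₁(D_b+D_f)/n})²·e^{−tT/n}`. [folklore] -/
private theorem exp_budget {n t δ₀ T D' D Db Df c₁ : ℝ} (hn : 0 < n) (ht : 0 ≤ t) (hδ₀ : 0 ≤ δ₀) (hT : 0 ≤ T) (hD' : 0 ≤ D')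
    (hc₁ : 0 ≤ c₁) (h1 : D ≤ T + D') (h2 : Df ≤ D' + c₁) (h3 : Db ≤ T + c₁) (hc : c₁ ≤ 4 * n) :
    Real.exp (2 * -(t * T / n)) * Real.exp (-(δ₀ * (n⁻¹ * D'))) ^ 2 ≤
      Real.exp (2 * t + 4 * δ₀) * (Real.exp (-(min (t / 4) (δ₀ / 2) * (n⁻¹ * D))) *
        Real.exp (-(min (t / 4) (δ₀ / 2) * (n⁻¹ * (Db + Df))))) ^ 2 * Real.exp (-(t * T / n)) := by
  set e : ℝ := min (t / 4) (δ₀ / 2) with he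
  have he0 : 0 ≤ e := le_min (by linarith) (by linarith)
  have het : 2 * e ≤ t / 2 := by have := min_le_left (t / 4) (δ₀ / 2); linarith
  have heδ : 2 * e ≤ δ₀ := by have := min_le_right (t / 4) (δ₀ / 2); linarith
  have p1 : 2 * e * D ≤ 2 * e * (T + D') := mul_le_mul_of_nonneg_left h1 (by linarith)
  have p2 : 2 * e * T ≤ t / 2 * T := mul_le_mul_of_nonneg_right het hT
  have p3 : 2 * e * D' ≤ δ₀ * D' := mul_le_mul_of_nonneg_right heδ hD'
  have p4 : 2 * e * Db ≤ 2 * e * (T + c₁) := mul_le_mul_of_nonneg_left h3 (by linarith)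
  have p5 : 2 * e * c₁ ≤ t / 2 * c₁ := mul_le_mul_of_nonneg_right het hc₁
  have p6 : t / 2 * c₁ ≤ t / 2 * (4 * n) := mul_le_mul_of_nonneg_left hc (by linarith)
  have p7 : 2 * e * Df ≤ 2 * e * (D' + c₁) := mul_le_mul_of_nonneg_left h2 (by linarith)
  have p8 : 2 * e * c₁ ≤ δ₀ * c₁ := mul_le_mul_of_nonneg_right heδ hc₁
  have p9 : δ₀ * c₁ ≤ δ₀ * (4 * n) := mul_le_mul_of_nonneg_left hc hδ₀
  have key : -(2 * t * T) - 2 * δ₀ * D' ≤ (2 * t + 4 * δ₀) * n - 2 * e * D - 2 * e * (Db + Df) - t * T := by nlinarith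
  have hA : Real.exp (2 * -(t * T / n)) * Real.exp (-(δ₀ * (n⁻¹ * D'))) ^ 2 =
      Real.exp ((-(2 * t * T) - 2 * δ₀ * D') / n) := by
    rw [← Real.exp_nat_mul, ← Real.exp_add]; congr 1; push_cast; field_simp; ring
  have hB : Real.exp (2 * t + 4 * δ₀) * (Real.exp (-(e * (n⁻¹ * D))) * Real.exp (-(e * (n⁻¹ * (Db + Df))))) ^ 2 *
      Real.exp (-(t * T / n)) = Real.exp (((2 * t + 4 * δ₀) * n - 2 * e * D - 2 * e * (Db + Df) - t * T) / n) := by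
    rw [← Real.exp_add, ← Real.exp_nat_mul, ← Real.exp_add, ← Real.exp_add]; congr 1; push_cast; field_simp; ring
  rw [hA, hB]
  exact Real.exp_le_exp.2 (div_le_div_of_nonneg_right key hn.le)

/-- kernel: the square-root step of the conclusion (p30's kernel, copied): `S ≤ A²BN`, `p√N ≤ 2C√S` (`A, B, C ≥ 0`, `N > 0`) ⟹ `p ≤ 2CA√B`.
[folklore] -/
private theorem sqrt_step {S A B N p C : ℝ} (hA : 0 ≤ A) (hB : 0 ≤ B) (hN : 0 < N) (hC : 0 ≤ C) (hS : S ≤ A ^ 2 * B * N)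
    (hp : p * Real.sqrt N ≤ 2 * C * Real.sqrt S) : p ≤ 2 * C * A * Real.sqrt B := by
  have hsN : 0 < Real.sqrt N := Real.sqrt_pos.2 hN
  have h1 : Real.sqrt S ≤ A * Real.sqrt B * Real.sqrt N := by
    calc Real.sqrt S ≤ Real.sqrt (A ^ 2 * B * N) := Real.sqrt_le_sqrt hS
      _ = A * Real.sqrt B * Real.sqrt N := by
          rw [Real.sqrt_mul (by positivity), Real.sqrt_mul (by positivity), Real.sqrt_sq hA]
  have h2 : p * Real.sqrt N ≤ (2 * C * A * Real.sqrt B) * Real.sqrt N := by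
    calc p * Real.sqrt N ≤ 2 * C * Real.sqrt S := hp
      _ ≤ 2 * C * (A * Real.sqrt B * Real.sqrt N) := mul_le_mul_of_nonneg_left h1 (by positivity)
      _ = (2 * C * A * Real.sqrt B) * Real.sqrt N := by ring
  exact le_of_mul_le_mul_right h2 hsN

/-- kernel: `e² < 8` (p30's kernel, copied). [folklore] -/
private theorem exp_two_lt_eight : Real.exp 2 < 8 := by
  have h := Real.exp_one_lt_d9
  have e : Real.exp 2 = Real.exp 1 * Real.exp 1 := by rw [← Real.exp_add]; norm_num
  rw [e]; nlinarith [Real.exp_pos 1]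

/-- kernel: **the collar, pointwise** (p30's kernel, copied): at a collar site `y` (`δ(y) ≤ 3n + 1`, `δ(y) = |y − w₁|_∞` for some `w₁ ∉ □`) a
function `v` obeying the two-member bound `‖v(y)‖ ≤ 2s·c₀Fe^{−δ₀D′/n}` for every admissible `D′ ≤ dist(y, supp f)` has tilted mass
`e^{−2t|x−y|/n}‖v(y)‖² ≤ (2sc₀F)²e^{2t+4δ₀}·(e^{−δ₁D/n}e^{−δ₁(D_b+D_f)/n})²·e^{−t|x−y|/n}`, `δ₁ = min(t/4, δ₀/2)`.
[cite: Balaban1983RegularityDecay, Theorem p.573 (1.12)] -/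
private theorem collar_pointwise {k : ℕ} (hk1 : 1 ≤ k) {B : Finset (Balaban1983to89.Site P 0)} {δ : Balaban1983to89.Site P 0 → ℕ}
    (h2 : ∀ y, ∃ w, w ∉ B ∧ δ y = supDist y w) {x y : Balaban1983to89.Site P 0}
    (hy3n : δ y ≤ 3 * P.L ^ k + 1) (f : Balaban1983to89.Site P 0 → ℂ) {F D Db Df c₀ δ₀ t s : ℝ} (hδ₀ : 0 ≤ δ₀) (ht : 0 ≤ t)
    (hsuppD : ∀ y', f y' ≠ 0 → D ≤ (supDist x y' : ℝ)) (hsuppDb : ∀ w, w ∉ B → Db ≤ (supDist x w : ℝ))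
    (hsuppDf : ∀ y', f y' ≠ 0 → ∀ w, w ∉ B → Df ≤ (supDist y' w : ℝ)) (v : Balaban1983to89.Site P 0 → ℂ)
    (hvD : ∀ D' : ℝ, 0 ≤ D' → (∀ y', f y' ≠ 0 → D' ≤ (supDist y y' : ℝ)) →
      ‖v y‖ ≤ 2 * s * c₀ * F * Real.exp (-(δ₀ * (((P.L : ℝ) ^ k)⁻¹ * D')))) :
    Real.exp (2 * -(t * (supDist x y : ℝ) / (P.L : ℝ) ^ k)) * ‖v y‖ ^ 2 ≤
      (2 * s * c₀ * F) ^ 2 * Real.exp (2 * t + 4 * δ₀) *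
        (Real.exp (-(min (t / 4) (δ₀ / 2) * (((P.L : ℝ) ^ k)⁻¹ * D))) *
          Real.exp (-(min (t / 4) (δ₀ / 2) * (((P.L : ℝ) ^ k)⁻¹ * (Db + Df))))) ^ 2 *
        Real.exp (-(t * (supDist x y : ℝ) / (P.L : ℝ) ^ k)) := by
  have hn0 : (0 : ℝ) < (P.L : ℝ) ^ k := pow_pos P.cast_L_pos k
  have hr2 : 2 ≤ P.L ^ k := Nat.one_lt_pow (by omega) P.hL.2
  have hn2 : (2 : ℝ) ≤ (P.L : ℝ) ^ k := by exact_mod_cast hr2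
  obtain ⟨w₁, hw₁, hδy⟩ := h2 y
  have hδy' : (supDist y w₁ : ℝ) ≤ 3 * (P.L : ℝ) ^ k + 1 := by rw [← hδy]; exact_mod_cast hy3n
  set D' : ℝ := max (max (Df - (3 * (P.L : ℝ) ^ k + 1)) (D - (supDist x y : ℝ))) 0 with hD'
  have hD'0 : 0 ≤ D' := le_max_right _ _
  have hD'supp : ∀ y', f y' ≠ 0 → D' ≤ (supDist y y' : ℝ) := by
    intro y' hy'
    refine max_le (max_le ?_ ?_) (Nat.cast_nonneg _)
    · have hh := hsuppDf y' hy' w₁ hw₁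
      have htri : (supDist y' w₁ : ℝ) ≤ supDist y' y + supDist y w₁ := by exact_mod_cast supDist_triangle y' y w₁
      have hsy : (supDist y' y : ℝ) = supDist y y' := by rw [supDist_comm]
      linarith
    · have hh := hsuppD y' hy'
      have htri : (supDist x y' : ℝ) ≤ supDist x y + supDist y y' := by exact_mod_cast supDist_triangle x y y'
      linarith
  have hvy := hvD D' hD'0 hD'supp
  have hvy2 : ‖v y‖ ^ 2 ≤ (2 * s * c₀ * F) ^ 2 * Real.exp (-(δ₀ * (((P.L : ℝ) ^ k)⁻¹ * D'))) ^ 2 := by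
    rw [← mul_pow]; exact pow_le_pow_left₀ (norm_nonneg _) hvy 2
  have hgeo1 : D ≤ (supDist x y : ℝ) + D' := by
    have : D - (supDist x y : ℝ) ≤ D' := (le_max_right _ _).trans (le_max_left _ _); linarith
  have hgeo2 : Df ≤ D' + (3 * (P.L : ℝ) ^ k + 1) := by
    have : Df - (3 * (P.L : ℝ) ^ k + 1) ≤ D' := (le_max_left _ _).trans (le_max_left _ _); linarith
  have hgeo3 : Db ≤ (supDist x y : ℝ) + (3 * (P.L : ℝ) ^ k + 1) := by
    have hh := hsuppDb w₁ hw₁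
    have htri : (supDist x w₁ : ℝ) ≤ supDist x y + supDist y w₁ := by exact_mod_cast supDist_triangle x y w₁
    linarith
  have hbud := exp_budget hn0 ht hδ₀ (Nat.cast_nonneg _) hD'0 (by positivity) hgeo1 hgeo2 hgeo3 (by linarith)
  calc Real.exp (2 * -(t * (supDist x y : ℝ) / (P.L : ℝ) ^ k)) * ‖v y‖ ^ 2
      ≤ Real.exp (2 * -(t * (supDist x y : ℝ) / (P.L : ℝ) ^ k)) *
          ((2 * s * c₀ * F) ^ 2 * Real.exp (-(δ₀ * (((P.L : ℝ) ^ k)⁻¹ * D'))) ^ 2) :=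
        mul_le_mul_of_nonneg_left hvy2 (Real.exp_pos _).le
    _ = (2 * s * c₀ * F) ^ 2 * (Real.exp (2 * -(t * (supDist x y : ℝ) / (P.L : ℝ) ^ k)) *
          Real.exp (-(δ₀ * (((P.L : ℝ) ^ k)⁻¹ * D'))) ^ 2) := by ring
    _ ≤ (2 * s * c₀ * F) ^ 2 * (Real.exp (2 * t + 4 * δ₀) *
        (Real.exp (-(min (t / 4) (δ₀ / 2) * (((P.L : ℝ) ^ k)⁻¹ * D))) *
          Real.exp (-(min (t / 4) (δ₀ / 2) * (((P.L : ℝ) ^ k)⁻¹ * (Db + Df))))) ^ 2 *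
        Real.exp (-(t * (supDist x y : ℝ) / (P.L : ℝ) ^ k))) :=
        mul_le_mul_of_nonneg_left hbud (sq_nonneg _)
    _ = _ := by ring

/-- kernel: **the mass near `x`** (p30's kernel, copied): where `η = 1` and `2g ≥ −14t`, `Σ_{ball}‖v‖² ≤ e^{14t}Σ_y(ηe^g)²‖v‖²`. [folklore] -/
private theorem ball_mass_le (x : Balaban1983to89.Site P 0) (R : ℕ) (v : Balaban1983to89.Site P 0 → ℂ)
    (η g : Balaban1983to89.Site P 0 → ℝ) {t : ℝ} (hη1 : ∀ y, supDist x y ≤ R → η y = 1)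
    (hg : ∀ y, supDist x y ≤ R → -(14 * t) ≤ 2 * g y) :
    ∑ y ∈ ball x R, ‖v y‖ ^ 2 ≤ Real.exp (14 * t) * ∑ y, (η y * Real.exp (g y)) ^ 2 * ‖v y‖ ^ 2 := by
  have hpt : ∀ y ∈ ball x R, ‖v y‖ ^ 2 ≤ Real.exp (14 * t) * ((η y * Real.exp (g y)) ^ 2 * ‖v y‖ ^ 2) := by
    intro y hy
    rw [mem_ball] at hy
    have hexp : 1 ≤ Real.exp (14 * t) * Real.exp (g y) ^ 2 := by
      rw [← Real.exp_nat_mul, ← Real.exp_add]; push_cast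
      exact Real.one_le_exp (by linarith [hg y hy])
    rw [hη1 y hy, one_mul]
    calc ‖v y‖ ^ 2 = 1 * ‖v y‖ ^ 2 := (one_mul _).symm
      _ ≤ (Real.exp (14 * t) * Real.exp (g y) ^ 2) * ‖v y‖ ^ 2 := mul_le_mul_of_nonneg_right hexp (sq_nonneg _)
      _ = _ := by ring
  calc ∑ y ∈ ball x R, ‖v y‖ ^ 2 ≤ ∑ y ∈ ball x R, Real.exp (14 * t) * ((η y * Real.exp (g y)) ^ 2 * ‖v y‖ ^ 2) := Finset.sum_le_sum hpt
    _ = Real.exp (14 * t) * ∑ y ∈ ball x R, (η y * Real.exp (g y)) ^ 2 * ‖v y‖ ^ 2 := by rw [Finset.mul_sum]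
    _ ≤ Real.exp (14 * t) * ∑ y, (η y * Real.exp (g y)) ^ 2 * ‖v y‖ ^ 2 :=
        mul_le_mul_of_nonneg_left (Finset.sum_le_sum_of_subset_of_nonneg (Finset.subset_univ _) fun _ _ _ => by positivity)
          (Real.exp_pos _).le

set_option maxHeartbeats 800000 in
/-- **THE `δG_k` VALUE MEMBER AT `U(1)` FIELDS PLAQUETTE-SMALL NEAR `Ω` ONLY, k-UNIFORM, OPERATOR FORM** — [Balaban1983RegularityDecay]
Theorem p. 573 (1.11)–(1.12) for [BalabanImbrieJaffe1988] (2.31) under its PRINTED hypothesis *"for (2.31) we assume smoothness throughout the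
subset Ω ⊂ T_η … (2.32)"*: p30's `close112_smallField_of_inputs` with the plaquette hypothesis asked ONLY for the plaquettes based within `2L^k`
of `Ω`.  For `2 ≤ d ≤ 3`, `L` odd `> 1`, `a > 0`, `c₀ ≥ 0`, `δ₀ > 0` there are `c₁, δ₁ > 0` (from these only) such that for every volume, every
`1 ≤ k ≤ K`, every `U(1)` field `u` with `‖u(∂p) − 1‖ ≤ θ` for the plaquettes based within `2L^k` of `Ω` (`0 ≤ θ`, `2d³(L^{2k}θ)² ≤ 1`), every
`T ≥ (d−1)(L^k−1)θ` with `2(L^k−1)L^k·d·T² + 2(d(L^k−1)T)² ≤ 1/2`, all nested `k`-block unions `□ ⊆ Ω` on whose `□`-rows `G_k(□,u)` and `G_k(Ω,u)`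
obey the (H1.10″) value bound with `(c₀, δ₀)` (HYPOTHESES — gen 20's `decay110_smoothNear_region` instantiates them under the same local
hypothesis), every row `x ∈ □` with `dist_∞(x, T ∖ □) ≥ 10L^k` and every `f` (`‖f‖_∞ ≤ F`, `D ≤ dist(x, supp f)`, `D_b ≤ dist(x, □^c)`,
`D_f ≤ dist(supp f, □^c)`): `‖(G_k(□,u)f)(x) − (G_k(Ω,u)f)(x)‖ ≤ (L^kε)²·c₁e^{−δ₁D/L^k}e^{−δ₁(D_b + D_f)/L^k}·F`.  Proof = p30's steps (1)–(8) VERBATIM with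
(2)–(3) the Agmon step `agmon_step_near` on `X = □` (plaquettes near `□ ⊆ Ω`) and (7) the centred tree gauge around the deep row `x` fed with the
plaquettes based within `2L^k + 2 ≤ 10L^k` of `x`, all in `□` (gen 20's `dist1_centredGaugeDir_le_supDist_of_near`).
[cite: Balaban1983RegularityDecay, Theorem p.573 (1.11)–(1.12)] [cite: BalabanImbrieJaffe1985, (7.3.1) p.326, (4.6.2) p.313]
[cite: BalabanImbrieJaffe1988, (2.31)–(2.32) p.263] -/
theorem close112_smoothNear_of_inputs (d L : ℕ) (hd : 2 ≤ d) (hd3 : d ≤ 3) (hL : Odd L ∧ 1 < L) {a : ℝ} (ha : 0 < a)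
    {c₀ δ₀ : ℝ} (hc₀ : 0 ≤ c₀) (hδ₀ : 0 < δ₀) :
    ∃ c₁ δ₁ : ℝ, 0 < c₁ ∧ 0 < δ₁ ∧ ∀ (P : Params), P.d = d → P.L = L → ∀ k : ℕ, 1 ≤ k → k ≤ P.K →
      ∀ (U : GaugeField P 0 U1) (Ω : Finset (Balaban1983to89.Site P 0)) (θ : ℝ), 0 ≤ θ →
      (∀ p : Balaban1983to89.Plaq P 0, (∃ y ∈ Ω, supDist y p.src ≤ 2 * P.L ^ k) → ‖toC (plaqHol U p) - 1‖ ≤ θ) →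
      2 * (P.d : ℝ) ^ 3 * (((P.L : ℝ) ^ k) ^ 2 * θ) ^ 2 ≤ 1 →
      ∀ (T : ℝ), ((P.d - 1 : ℕ) : ℝ) * ((P.L : ℝ) ^ k - 1) * θ ≤ T →
        2 * (((P.L : ℝ) ^ k - 1) * (P.L : ℝ) ^ k) * P.d * T ^ 2 + 2 * (P.d * ((P.L : ℝ) ^ k - 1) * T) ^ 2 ≤ 1 / 2 →
      ∀ (B : Finset (Balaban1983to89.Site P 0)), IsBlockUnion k B → IsBlockUnion k Ω → B ⊆ Ω →
      (∀ x ∈ B, ∀ (f : Balaban1983to89.Site P 0 → ℂ) (F D : ℝ), (∀ y, ‖f y‖ ≤ F) → 0 ≤ D →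
          (∀ y, f y ≠ 0 → D ≤ B5Ineq137Torus.T P 0 x y) →
          ‖(gBox (B1RG242Torus.α P a k * (P.L : ℝ) ^ (k * P.d)) P.eps⁻¹ U k B *ᵥ f) x‖ ≤
            P.spacing k ^ 2 * (c₀ * Real.exp (-(δ₀ * (((P.L : ℝ) ^ k)⁻¹ * D))) * F)) →
      (∀ x ∈ B, ∀ (f : Balaban1983to89.Site P 0 → ℂ) (F D : ℝ), (∀ y, ‖f y‖ ≤ F) → 0 ≤ D →
          (∀ y, f y ≠ 0 → D ≤ B5Ineq137Torus.T P 0 x y) →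
          ‖(gBox (B1RG242Torus.α P a k * (P.L : ℝ) ^ (k * P.d)) P.eps⁻¹ U k Ω *ᵥ f) x‖ ≤
            P.spacing k ^ 2 * (c₀ * Real.exp (-(δ₀ * (((P.L : ℝ) ^ k)⁻¹ * D))) * F)) →
      ∀ x ∈ B, (∀ w, w ∉ B → 10 * (P.L : ℝ) ^ k ≤ B5Ineq137Torus.T P 0 x w) →
      ∀ (f : Balaban1983to89.Site P 0 → ℂ) (F D Db Df : ℝ), (∀ y, ‖f y‖ ≤ F) → (∀ y, y ∉ B → f y = 0) →
        0 ≤ D → (∀ y, f y ≠ 0 → D ≤ B5Ineq137Torus.T P 0 x y) → 0 ≤ Db → (∀ w, w ∉ B → Db ≤ B5Ineq137Torus.T P 0 x w) →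
        0 ≤ Df → (∀ y, f y ≠ 0 → ∀ w, w ∉ B → Df ≤ B5Ineq137Torus.T P 0 y w) →
        ‖(gBox (B1RG242Torus.α P a k * (P.L : ℝ) ^ (k * P.d)) P.eps⁻¹ U k B *ᵥ f) x -
            (gBox (B1RG242Torus.α P a k * (P.L : ℝ) ^ (k * P.d)) P.eps⁻¹ U k Ω *ᵥ f) x‖ ≤
          P.spacing k ^ 2 * (c₁ * Real.exp (-(δ₁ * (((P.L : ℝ) ^ k)⁻¹ * D))) *
            Real.exp (-(δ₁ * (((P.L : ℝ) ^ k)⁻¹ * (Db + Df)))) * F) := by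
  classical
  obtain ⟨Cmv, hCmv, hmv⟩ := harmonic_meanValue d L hd hd3 hL ha
  -- the tilt rate `t`, from `t²(2d + a)e^{2t} ≤ m_*/2`
  have hL1 : (1 : ℝ) < L := by exact_mod_cast hL.2
  have hinf0 : 0 < a * (1 - ((L : ℝ) ^ 2)⁻¹) := by
    have : ((L : ℝ) ^ 2)⁻¹ < 1 := inv_lt_one_of_one_lt₀ (by nlinarith)
    exact mul_pos ha (by linarith)
  have hmlo0 : 0 < min (a * (1 - ((L : ℝ) ^ 2)⁻¹) / 4) (1 / 4) := lt_min (by linarith) (by norm_num)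
  have hda : (0 : ℝ) < 2 * d + a := by positivity
  obtain ⟨t, ht0, ht1, htu⟩ : ∃ t : ℝ, 0 < t ∧ t ≤ 1 ∧
      t ^ 2 * (2 * d + a) * Real.exp (2 * t) ≤ min (a * (1 - ((L : ℝ) ^ 2)⁻¹) / 4) (1 / 4) / 2 := by
    refine ⟨min 1 (min (a * (1 - ((L : ℝ) ^ 2)⁻¹) / 4) (1 / 4) / (16 * (2 * d + a))), lt_min one_pos (by positivity),
      min_le_left _ _, ?_⟩
    set m := min (a * (1 - ((L : ℝ) ^ 2)⁻¹) / 4) (1 / 4)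
    set t := min 1 (m / (16 * (2 * d + a))) with htdef
    have ht0 : 0 < t := lt_min one_pos (by positivity)
    have ht1 : t ≤ 1 := min_le_left _ _
    have h1 : t ≤ m / (16 * (2 * d + a)) := min_le_right _ _
    have h2 : t ^ 2 ≤ t := by nlinarith
    have h3 : Real.exp (2 * t) ≤ 8 := by
      have := Real.exp_le_exp.2 (show 2 * t ≤ 2 by linarith); linarith [exp_two_lt_eight]
    calc t ^ 2 * (2 * d + a) * Real.exp (2 * t) ≤ t * (2 * d + a) * 8 := by gcongr
      _ ≤ m / (16 * (2 * d + a)) * (2 * d + a) * 8 := by gcongr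
      _ = m / 2 := by field_simp; ring
  -- the constants
  set K₁ : ℝ := 2 * Real.exp (2 * t) * (2 * d + a) / min (a * (1 - ((L : ℝ) ^ 2)⁻¹) / 4) (1 / 4) with hK₁
  have hK₁0 : 0 ≤ K₁ := by positivity
  set Bc : ℝ := Real.exp (14 * t) * K₁ * (2 * (1 + d / t)) ^ d with hBc
  have hBc0 : 0 ≤ Bc := by positivity
  refine ⟨2 * Cmv * (2 * c₀ * Real.exp (t + 2 * δ₀)) * Real.sqrt Bc + 1, min (t / 4) (δ₀ / 2), by positivity,
    lt_min (by linarith) (by linarith), ?_⟩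
  intro P hPd hPL k hk1 hkK U Ω θ hθ0 hplaq hsmall T hTθ hsmall2 B hB hΩ hsub hGB hGΩ x hxB hdeep f F D Db Df hF _ hD hsuppD hDb
    hsuppDb hDf hsuppDf
  subst hPd; subst hPL
  -- basic quantities
  have hk : k ≤ P.m + P.K := hkK.trans (Nat.le_add_left _ _)
  have hk0 : 0 + k ≤ P.m + P.K := by omega
  have hr2 : 2 ≤ P.L ^ k := Nat.one_lt_pow (by omega) P.hL.2
  have hncast : ((P.L ^ k : ℕ) : ℝ) = (P.L : ℝ) ^ k := by push_cast; rfl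
  have hn0 : (0 : ℝ) < (P.L : ℝ) ^ k := pow_pos P.cast_L_pos k
  have hn2 : (2 : ℝ) ≤ (P.L : ℝ) ^ k := by exact_mod_cast hr2
  have hα : 0 < B1RG242Torus.α P a k :=
    mul_pos (B1.aSeq_pos ha (B1RG242Torus.one_lt_cast_L P) hk1) (inv_pos.2 (pow_pos (P.spacing_pos k) 2))
  have hA'0 : 0 < B1RG242Torus.α P a k * (P.L : ℝ) ^ (k * P.d) := mul_pos hα (pow_pos P.cast_L_pos _)
  have hc' : P.eps⁻¹ ≠ 0 := inv_ne_zero P.eps_pos.ne'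
  have hF0 : 0 ≤ F := (norm_nonneg _).trans (hF x)
  have hT : ∀ y z : Balaban1983to89.Site P 0, B5Ineq137Torus.T P 0 y z = (supDist y z : ℝ) :=
    fun y z => B3Bound323ZeroTorus.T_eq_supDist P y z
  -- the function `v` and the target
  set v : Balaban1983to89.Site P 0 → ℂ := fun y => (gBox (B1RG242Torus.α P a k * (P.L : ℝ) ^ (k * P.d)) P.eps⁻¹ U k B *ᵥ f) y -
    (gBox (B1RG242Torus.α P a k * (P.L : ℝ) ^ (k * P.d)) P.eps⁻¹ U k Ω *ᵥ f) y with hv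
  set EXP : ℝ := Real.exp (-(min (t / 4) (δ₀ / 2) * (((P.L : ℝ) ^ k)⁻¹ * D))) *
    Real.exp (-(min (t / 4) (δ₀ / 2) * (((P.L : ℝ) ^ k)⁻¹ * (Db + Df)))) with hEXP
  have hEXP0 : 0 ≤ EXP := by positivity
  show ‖v x‖ ≤ _
  have hgoal : P.spacing k ^ 2 * ((2 * Cmv * (2 * c₀ * Real.exp (t + 2 * δ₀)) * Real.sqrt Bc + 1) *
      Real.exp (-(min (t / 4) (δ₀ / 2) * (((P.L : ℝ) ^ k)⁻¹ * D))) *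
      Real.exp (-(min (t / 4) (δ₀ / 2) * (((P.L : ℝ) ^ k)⁻¹ * (Db + Df)))) * F) =
      P.spacing k ^ 2 * (2 * Cmv * (2 * c₀ * Real.exp (t + 2 * δ₀)) * Real.sqrt Bc + 1) * EXP * F := by rw [hEXP]; ring
  rw [hgoal]
  -- the trivial case `□ = T`
  by_cases hBT : B = univ
  · have hΩT : Ω = univ := Finset.eq_univ_of_forall fun y => hsub (hBT ▸ mem_univ y)
    have h0 : v x = 0 := by
      show (gBox _ _ U k B *ᵥ f) x - (gBox _ _ U k Ω *ᵥ f) x = 0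
      rw [hBT, hΩT, sub_self]
    rw [h0, norm_zero]; positivity
  -- the depth function; the torus is large
  obtain ⟨δ, h1, h2⟩ := exists_depth hBT
  obtain ⟨w₀, hw₀, hδx⟩ := h2 x
  have hδx10 : 10 * P.L ^ k ≤ δ x := by
    have hh := hdeep w₀ hw₀
    rw [hT, ← hδx, ← hncast] at hh
    exact_mod_cast hh
  have hNbig : 4 * P.L ^ k + 7 ≤ P.sitesPerDir 0 := by
    have h3 := supDist_le_half x w₀
    rw [← hδx] at h3
    omega
  -- every site within `10L^k` of `x` lies in `□` (hence in `Ω`): the plaquettes read by the gauges are near `□`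
  have hnearB : ∀ z : Balaban1983to89.Site P 0, supDist x z < 10 * P.L ^ k → z ∈ B := by
    intro z hz
    by_contra hzB
    have hh := hdeep z hzB
    rw [hT, ← hncast] at hh
    have : (10 * P.L ^ k : ℕ) ≤ supDist x z := by exact_mod_cast hh
    omega
  have hplaqB : ∀ p : Balaban1983to89.Plaq P 0, (∃ y ∈ B, supDist y p.src ≤ 2 * P.L ^ k) → ‖toC (plaqHol U p) - 1‖ ≤ θ :=
    fun p ⟨y, hyB, hy⟩ => hplaq p ⟨y, hsub hyB, hy⟩
  -- (1) `v` is harmonic where the depth is `≥ 2`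
  have hharm : ∀ y, 2 ≤ δ y → (nOp (B1RG242Torus.α P a k * (P.L : ℝ) ^ (k * P.d)) P.eps⁻¹ U k univ *ᵥ v) y = 0 := by
    intro y hy
    obtain ⟨hyB, hs, hu⟩ := interior_of_depth_two h1 h2 hy
    exact nOp_univ_diff_apply_eq_zero hk0 hc' hA'0 U hB hΩ hsub f hyB hs hu
  -- (2)–(3) the cutoff, the tilt, the collar set, the Agmon bound UNDER THE LOCAL HYPOTHESIS (`η` is supported in `□`)
  obtain ⟨-, hηL, hη1, hη0, hηS⟩ := cutoff_props h1 h2 k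
  have hSmem : ∀ y, y ∈ (univ.filter fun y : Balaban1983to89.Site P 0 => 3 ≤ δ y ∧ δ y ≤ 3 * P.L ^ k + 1) ↔
      3 ≤ δ y ∧ δ y ≤ 3 * P.L ^ k + 1 := fun y => by rw [Finset.mem_filter]; simp
  have hag := agmon_step_near ha hk1 hk U hB hθ0 hplaqB (by omega) hTθ hsmall2 v
    (fun y => min 1 (max 0 (((δ y : ℝ) - (P.L : ℝ) ^ k - 2) / (P.L : ℝ) ^ k)))
    (fun y => -(t * (supDist x y : ℝ) / (P.L : ℝ) ^ k)) ht0.le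
    (fun y hy => mem_of_depth_pos h1 (by by_contra hlt; exact hy (hη0 y (by omega))))
    (fun y y' => hηL y y') (fun y y' => tilt_lipschitz x ht0.le hn0 y y')
    (univ.filter fun y => 3 ≤ δ y ∧ δ y ≤ 3 * P.L ^ k + 1) (fun y y' hd hne => (hSmem y).2 (hηS y y' hd hne))
    (fun y hy => hharm y (by by_contra hlt; exact hy (hη0 y (by omega)))) htu
  -- (4)–(5) the collar sum
  have hsuppD' : ∀ y', f y' ≠ 0 → D ≤ (supDist x y' : ℝ) := fun y' hy' => by rw [← hT]; exact hsuppD y' hy'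
  have hsuppDb' : ∀ w, w ∉ B → Db ≤ (supDist x w : ℝ) := fun w hw => by rw [← hT]; exact hsuppDb w hw
  have hsuppDf' : ∀ y', f y' ≠ 0 → ∀ w, w ∉ B → Df ≤ (supDist y' w : ℝ) := fun y' hy' w hw => by rw [← hT]; exact hsuppDf y' hy' w hw
  have hcollar : ∀ y ∈ (univ.filter fun y : Balaban1983to89.Site P 0 => 3 ≤ δ y ∧ δ y ≤ 3 * P.L ^ k + 1),
      Real.exp (2 * -(t * (supDist x y : ℝ) / (P.L : ℝ) ^ k)) * ‖v y‖ ^ 2 ≤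
        (2 * P.spacing k ^ 2 * c₀ * F) ^ 2 * Real.exp (2 * t + 4 * δ₀) * EXP ^ 2 *
          Real.exp (-(t * (supDist x y : ℝ) / (P.L : ℝ) ^ k)) := by
    intro y hyS
    obtain ⟨hy3, hy3n⟩ := (hSmem y).1 hyS
    have hyB : y ∈ B := mem_of_depth_pos h1 (by omega)
    refine collar_pointwise hk1 h2 hy3n f hδ₀.le ht0.le hsuppD' hsuppDb' hsuppDf' v fun D' hD'0 hD'supp => ?_
    have hD's : ∀ y', f y' ≠ 0 → D' ≤ B5Ineq137Torus.T P 0 y y' := fun y' hy' => by rw [hT]; exact hD'supp y' hy'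
    have hGBy := hGB y hyB f F D' hF hD'0 hD's
    have hGΩy := hGΩ y hyB f F D' hF hD'0 hD's
    calc ‖v y‖ ≤ ‖(gBox (B1RG242Torus.α P a k * (P.L : ℝ) ^ (k * P.d)) P.eps⁻¹ U k B *ᵥ f) y‖ +
          ‖(gBox (B1RG242Torus.α P a k * (P.L : ℝ) ^ (k * P.d)) P.eps⁻¹ U k Ω *ᵥ f) y‖ := norm_sub_le _ _
      _ ≤ _ := add_le_add hGBy hGΩy
      _ = 2 * P.spacing k ^ 2 * c₀ * F * Real.exp (-(δ₀ * (((P.L : ℝ) ^ k)⁻¹ * D'))) := by ring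
  have hsumS : ∑ y ∈ (univ.filter fun y : Balaban1983to89.Site P 0 => 3 ≤ δ y ∧ δ y ≤ 3 * P.L ^ k + 1),
      Real.exp (2 * -(t * (supDist x y : ℝ) / (P.L : ℝ) ^ k)) * ‖v y‖ ^ 2 ≤
      (2 * P.spacing k ^ 2 * c₀ * F) ^ 2 * Real.exp (2 * t + 4 * δ₀) * EXP ^ 2 * ((2 * (1 + P.d / t)) ^ P.d * ((P.L : ℝ) ^ k) ^ P.d) := by
    have hrad : ∑ y ∈ (univ.filter fun y : Balaban1983to89.Site P 0 => 3 ≤ δ y ∧ δ y ≤ 3 * P.L ^ k + 1),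
        Real.exp (-(t * (supDist x y : ℝ) / (P.L : ℝ) ^ k)) ≤ (2 * (1 + P.d / t)) ^ P.d * ((P.L : ℝ) ^ k) ^ P.d :=
      (Finset.sum_le_sum_of_subset_of_nonneg (Finset.subset_univ _) fun _ _ _ => (Real.exp_pos _).le).trans
        (BIJ85FreeResolventTiltedRow.sum_exp_neg_supDist_scale_le (P := P) ht0 k x)
    refine (Finset.sum_le_sum hcollar).trans ?_
    rw [← Finset.mul_sum]
    exact mul_le_mul_of_nonneg_left hrad (by positivity)
  -- (6) the mass near `x`
  have hball := ball_mass_le x (5 * P.L ^ k + 2) v (fun y => min 1 (max 0 (((δ y : ℝ) - (P.L : ℝ) ^ k - 2) / (P.L : ℝ) ^ k)))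
    (fun y => -(t * (supDist x y : ℝ) / (P.L : ℝ) ^ k)) (t := t)
    (fun y hy => hη1 y (by have := depth_le_add h1 h2 x y; omega))
    (fun y hy => by
      have h7 : (supDist x y : ℝ) ≤ 7 * (P.L : ℝ) ^ k := by
        have : ((supDist x y : ℕ) : ℝ) ≤ ((5 * P.L ^ k + 2 : ℕ) : ℝ) := by exact_mod_cast hy
        push_cast at this; linarith
      have : t * (supDist x y : ℝ) / (P.L : ℝ) ^ k ≤ 7 * t := by
        rw [div_le_iff₀ hn0]; nlinarith [ht0.le]
      show -(14 * t) ≤ 2 * -(t * (supDist x y : ℝ) / (P.L : ℝ) ^ k)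
      linarith)
  have hS' : ∑ y ∈ ball x (5 * P.L ^ k + 2), ‖v y‖ ^ 2 ≤
      (2 * P.spacing k ^ 2 * c₀ * F * Real.exp (t + 2 * δ₀) * EXP) ^ 2 * Bc * ((P.L : ℝ) ^ k) ^ P.d := by
    calc ∑ y ∈ ball x (5 * P.L ^ k + 2), ‖v y‖ ^ 2 ≤ _ := hball
      _ ≤ Real.exp (14 * t) * (K₁ * ∑ y ∈ (univ.filter fun y : Balaban1983to89.Site P 0 => 3 ≤ δ y ∧ δ y ≤ 3 * P.L ^ k + 1),
            Real.exp (2 * -(t * (supDist x y : ℝ) / (P.L : ℝ) ^ k)) * ‖v y‖ ^ 2) := by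
          refine mul_le_mul_of_nonneg_left ?_ (Real.exp_pos _).le
          rw [hK₁]; exact hag
      _ ≤ Real.exp (14 * t) * (K₁ * ((2 * P.spacing k ^ 2 * c₀ * F) ^ 2 * Real.exp (2 * t + 4 * δ₀) * EXP ^ 2 *
            ((2 * (1 + P.d / t)) ^ P.d * ((P.L : ℝ) ^ k) ^ P.d))) := by gcongr
      _ = (2 * P.spacing k ^ 2 * c₀ * F * Real.exp (t + 2 * δ₀) * EXP) ^ 2 * Bc * ((P.L : ℝ) ^ k) ^ P.d := by
          rw [hBc, show Real.exp (2 * t + 4 * δ₀) = Real.exp (t + 2 * δ₀) ^ 2 by rw [← Real.exp_nat_mul]; ring_nf]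
          ring
  -- (7) the centred tree gauge around `x` (reading plaquettes within `2L^k + 2 ≤ 10L^k` of `x`, all in `□`) and the mean-value inequality
  set i₀ : Fin P.d := ⟨0, lt_of_lt_of_le Nat.zero_lt_one P.hd⟩ with hi₀
  have hψharm : ∀ y, supDist x y ≤ 4 * P.L ^ k + 2 →
      (nOp (B1RG242Torus.α P a k * (P.L : ℝ) ^ (k * P.d)) P.eps⁻¹ (gaugeAct (centredGaugeDir U x (2 * P.L ^ k) i₀) U) k univ *ᵥ
        fun y => toC (centredGaugeDir U x (2 * P.L ^ k) i₀ y) * v y) y = 0 := by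
    intro y hy
    rw [nOp_gaugeAct_mulVec_smul hk0]
    show toC _ * _ = 0
    rw [hharm y (by have := depth_le_add h1 h2 x y; omega), mul_zero]
  have hγn : ((P.d - 1 : ℕ) : ℝ) * θ * ((P.L : ℝ) ^ k) ^ 2 ≤ 1 := gamma_nsq_le_one hθ0 P.hd hsmall
  have hnearx : ∀ p : Balaban1983to89.Plaq P 0, supDist x p.src ≤ 2 * P.L ^ k + 2 → dist1 (plaqHol U p) ≤ θ := by
    intro p hp
    rw [dist1_eq_norm_toC_sub_one]
    refine hplaqB p ⟨p.src, hnearB p.src (by omega), ?_⟩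
    rw [(supDist_eq_zero_iff _ _).2 rfl]; exact Nat.zero_le _
  have hgauge : ∀ y (ν : Fin P.d), supDist x y ≤ 2 * P.L ^ k →
      ‖cfg (gaugeAct (centredGaugeDir U x (2 * P.L ^ k) i₀) U) ⟨y, ν⟩ - 1‖ ≤ ((P.d - 1 : ℕ) : ℝ) * θ * supDist x y := by
    intro y ν hy
    have hR : 2 * (2 * P.L ^ k) + 4 < P.sitesPerDir 0 := by omega
    have hh := dist1_centredGaugeDir_le_supDist_of_near U hθ0 x hnearx hR i₀ y hy ν
    rw [dist1_eq_norm_toC_sub_one] at hh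
    calc ‖cfg (gaugeAct (centredGaugeDir U x (2 * P.L ^ k) i₀) U) ⟨y, ν⟩ - 1‖
        = ‖toC (gaugeAct (centredGaugeDir U x (2 * P.L ^ k) i₀) U ⟨y, ν⟩) - 1‖ := rfl
      _ ≤ ((P.d - 1 : ℕ) : ℝ) * (supDist x y : ℝ) * θ := hh
      _ = ((P.d - 1 : ℕ) : ℝ) * θ * supDist x y := by ring
  have hmvx := hmv P rfl rfl k hk1 hkK (by omega) x _ _ (((P.d - 1 : ℕ) : ℝ) * θ) (by positivity) hψharm hgauge
  have hnormψ : ∀ y, ‖toC (centredGaugeDir U x (2 * P.L ^ k) i₀ y) * v y‖ = ‖v y‖ := fun y => by rw [norm_mul, norm_toC, one_mul]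
  simp only [hnormψ] at hmvx
  -- (8) conclusion
  have hmvx' : ‖v x‖ * Real.sqrt (((P.L : ℝ) ^ k) ^ P.d) ≤ 2 * Cmv * Real.sqrt (∑ y ∈ ball x (5 * P.L ^ k + 2), ‖v y‖ ^ 2) := by
    refine hmvx.trans (mul_le_mul_of_nonneg_right ?_ (Real.sqrt_nonneg _))
    nlinarith
  have hfin := sqrt_step (by positivity : 0 ≤ 2 * P.spacing k ^ 2 * c₀ * F * Real.exp (t + 2 * δ₀) * EXP) hBc0 (pow_pos hn0 _)
    hCmv.le hS' hmvx'
  calc ‖v x‖ ≤ 2 * Cmv * (2 * P.spacing k ^ 2 * c₀ * F * Real.exp (t + 2 * δ₀) * EXP) * Real.sqrt Bc := hfin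
    _ = P.spacing k ^ 2 * (2 * Cmv * (2 * c₀ * Real.exp (t + 2 * δ₀)) * Real.sqrt Bc) * EXP * F := by ring
    _ ≤ P.spacing k ^ 2 * (2 * Cmv * (2 * c₀ * Real.exp (t + 2 * δ₀)) * Real.sqrt Bc + 1) * EXP * F := by
        have h0 : 0 ≤ P.spacing k ^ 2 * EXP * F := by positivity
        nlinarith

/-- **THE SAME, LITERALLY AS HYPOTHESIS `hC` OF `BIJ88DeltaLocClose235General.opClose231_gen`, UNDER PLAQUETTE SMALLNESS NEAR `Ω` ONLY**: for a
family of `k`-block unions `□_α ⊆ Ω` (the cubes of the partition of unity) with row sets `X_α` of sites of `□_α` at sup-depth `≥ 10L^k`, and the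
(H1.10″) value members of every `G_k(□_α,u)` and of `G_k(Ω,u)` on the rows of the `□_α`: the (H1.12″) closeness binder with constants `(c₁, δ₁)`.
[cite: Balaban1983RegularityDecay, Theorem p.573 (1.11)–(1.12)] [cite: BalabanImbrieJaffe1988, (2.31)–(2.32) p.263] -/
theorem close112_smoothNear_hC (d L : ℕ) (hd : 2 ≤ d) (hd3 : d ≤ 3) (hL : Odd L ∧ 1 < L) {a : ℝ} (ha : 0 < a)
    {c₀ δ₀ : ℝ} (hc₀ : 0 ≤ c₀) (hδ₀ : 0 < δ₀) :
    ∃ c₁ δ₁ : ℝ, 0 < c₁ ∧ 0 < δ₁ ∧ ∀ (P : Params), P.d = d → P.L = L → ∀ k : ℕ, 1 ≤ k → k ≤ P.K →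
      ∀ (U : GaugeField P 0 U1) (Ω : Finset (Balaban1983to89.Site P 0)) (θ : ℝ), 0 ≤ θ →
      (∀ p : Balaban1983to89.Plaq P 0, (∃ y ∈ Ω, supDist y p.src ≤ 2 * P.L ^ k) → ‖toC (plaqHol U p) - 1‖ ≤ θ) →
      2 * (P.d : ℝ) ^ 3 * (((P.L : ℝ) ^ k) ^ 2 * θ) ^ 2 ≤ 1 →
      ∀ (T : ℝ), ((P.d - 1 : ℕ) : ℝ) * ((P.L : ℝ) ^ k - 1) * θ ≤ T →
        2 * (((P.L : ℝ) ^ k - 1) * (P.L : ℝ) ^ k) * P.d * T ^ 2 + 2 * (P.d * ((P.L : ℝ) ^ k - 1) * T) ^ 2 ≤ 1 / 2 →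
      ∀ {ι : Type*} (cube Xr : ι → Finset (Balaban1983to89.Site P 0)),
      IsBlockUnion k Ω → (∀ α, IsBlockUnion k (cube α)) → (∀ α, cube α ⊆ Ω) →
      (∀ α, ∀ x ∈ Xr α, x ∈ cube α ∧ ∀ w, w ∉ cube α → 10 * (P.L : ℝ) ^ k ≤ B5Ineq137Torus.T P 0 x w) →
      (∀ α, ∀ x ∈ cube α, ∀ (f : Balaban1983to89.Site P 0 → ℂ) (F D : ℝ), (∀ y, ‖f y‖ ≤ F) → 0 ≤ D →
          (∀ y, f y ≠ 0 → D ≤ B5Ineq137Torus.T P 0 x y) →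
          ‖(gBox (B1RG242Torus.α P a k * (P.L : ℝ) ^ (k * P.d)) P.eps⁻¹ U k (cube α) *ᵥ f) x‖ ≤
            P.spacing k ^ 2 * (c₀ * Real.exp (-(δ₀ * (((P.L : ℝ) ^ k)⁻¹ * D))) * F)) →
      (∀ α, ∀ x ∈ cube α, ∀ (f : Balaban1983to89.Site P 0 → ℂ) (F D : ℝ), (∀ y, ‖f y‖ ≤ F) → 0 ≤ D →
          (∀ y, f y ≠ 0 → D ≤ B5Ineq137Torus.T P 0 x y) →
          ‖(gBox (B1RG242Torus.α P a k * (P.L : ℝ) ^ (k * P.d)) P.eps⁻¹ U k Ω *ᵥ f) x‖ ≤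
            P.spacing k ^ 2 * (c₀ * Real.exp (-(δ₀ * (((P.L : ℝ) ^ k)⁻¹ * D))) * F)) →
      ∀ α, ∀ x ∈ Xr α, ∀ (f : Balaban1983to89.Site P 0 → ℂ) (F D Db Df : ℝ), (∀ y, ‖f y‖ ≤ F) → (∀ y, y ∉ cube α → f y = 0) →
        0 ≤ D → (∀ y, f y ≠ 0 → D ≤ B5Ineq137Torus.T P 0 x y) → 0 ≤ Db → (∀ w, w ∉ cube α → Db ≤ B5Ineq137Torus.T P 0 x w) →
        0 ≤ Df → (∀ y, f y ≠ 0 → ∀ w, w ∉ cube α → Df ≤ B5Ineq137Torus.T P 0 y w) →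
        ‖(gBox (B1RG242Torus.α P a k * (P.L : ℝ) ^ (k * P.d)) P.eps⁻¹ U k (cube α) *ᵥ f) x -
            (gBox (B1RG242Torus.α P a k * (P.L : ℝ) ^ (k * P.d)) P.eps⁻¹ U k Ω *ᵥ f) x‖ ≤
          P.spacing k ^ 2 * (c₁ * Real.exp (-(δ₁ * (((P.L : ℝ) ^ k)⁻¹ * D))) *
            Real.exp (-(δ₁ * (((P.L : ℝ) ^ k)⁻¹ * (Db + Df)))) * F) := by
  obtain ⟨c₁, δ₁, hc₁, hδ₁, h⟩ := close112_smoothNear_of_inputs d L hd hd3 hL ha hc₀ hδ₀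
  refine ⟨c₁, δ₁, hc₁, hδ₁, ?_⟩
  intro P hPd hPL k hk1 hkK U Ω θ hθ0 hplaq hsmall T hTθ hsmall2 ι cube Xr hΩ hcube hsub hXr hGcube hGΩ α x hx
  exact h P hPd hPL k hk1 hkK U Ω θ hθ0 hplaq hsmall T hTθ hsmall2 (cube α) (hcube α) hΩ (hsub α) (hGcube α) (hGΩ α) x (hXr α x hx).1
    (hXr α x hx).2

/-- **THE SAME UNDER THE PRINTED (2.32) NEAR `Ω`** (*"for (2.31) we assume smoothness throughout the subset Ω ⊂ T_η. This means that … there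
exists an A, λ such that u = exp[ie_kη(A + ∂λ)] with |∂A|, |∂*A| ≦ O(p(e_k)). (2.32)"*): if `SmoothOn e_k η C 𝓅 X B Pl (cfg u)` (r18's typed
(2.32)) with `Pl ⊇` the plaquettes based within `2L^k` of `Ω` and `B ⊇` the four bonds of each plaquette of `Pl` (`0 ≤ e_k`, `0 ≤ C𝓅`), then the
(H1.12″) binder of `close112_smoothNear_hC` holds with `θ = e_kη²C𝓅` — gen 20's `plaqSmall_near_of_smoothOn`.
[cite: BalabanImbrieJaffe1988, (2.31)–(2.32) p.263] [cite: Balaban1983RegularityDecay, Theorem p.573 (1.11)–(1.12)] -/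
theorem close112_smoothOn_hC (d L : ℕ) (hd : 2 ≤ d) (hd3 : d ≤ 3) (hL : Odd L ∧ 1 < L) {a : ℝ} (ha : 0 < a)
    {c₀ δ₀ : ℝ} (hc₀ : 0 ≤ c₀) (hδ₀ : 0 < δ₀) :
    ∃ c₁ δ₁ : ℝ, 0 < c₁ ∧ 0 < δ₁ ∧ ∀ (P : Params), P.d = d → P.L = L → ∀ k : ℕ, 1 ≤ k → k ≤ P.K →
      ∀ (U : GaugeField P 0 U1) (Ω : Finset (Balaban1983to89.Site P 0)) (ek η C pek : ℝ), 0 ≤ ek → 0 ≤ C * pek →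
      ∀ (X : Finset (Balaban1983to89.Site P 0)) (Bd : Finset (PBond P 0)) (Pl : Finset (Balaban1983to89.Plaq P 0)),
        SmoothOn ek η C pek X Bd Pl (cfg U) →
        (∀ p : Balaban1983to89.Plaq P 0, (∃ y ∈ Ω, supDist y p.src ≤ 2 * P.L ^ k) → p ∈ Pl) →
        (∀ p ∈ Pl, (⟨p.src, p.μ⟩ : PBond P 0) ∈ Bd ∧ (⟨p.src.shift p.μ, p.ν⟩ : PBond P 0) ∈ Bd ∧
          (⟨p.src.shift p.ν, p.μ⟩ : PBond P 0) ∈ Bd ∧ (⟨p.src, p.ν⟩ : PBond P 0) ∈ Bd) →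
      2 * (P.d : ℝ) ^ 3 * (((P.L : ℝ) ^ k) ^ 2 * (ek * η ^ 2 * (C * pek))) ^ 2 ≤ 1 →
      ∀ (T : ℝ), ((P.d - 1 : ℕ) : ℝ) * ((P.L : ℝ) ^ k - 1) * (ek * η ^ 2 * (C * pek)) ≤ T →
        2 * (((P.L : ℝ) ^ k - 1) * (P.L : ℝ) ^ k) * P.d * T ^ 2 + 2 * (P.d * ((P.L : ℝ) ^ k - 1) * T) ^ 2 ≤ 1 / 2 →
      ∀ {ι : Type*} (cube Xr : ι → Finset (Balaban1983to89.Site P 0)),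
      IsBlockUnion k Ω → (∀ α, IsBlockUnion k (cube α)) → (∀ α, cube α ⊆ Ω) →
      (∀ α, ∀ x ∈ Xr α, x ∈ cube α ∧ ∀ w, w ∉ cube α → 10 * (P.L : ℝ) ^ k ≤ B5Ineq137Torus.T P 0 x w) →
      (∀ α, ∀ x ∈ cube α, ∀ (f : Balaban1983to89.Site P 0 → ℂ) (F D : ℝ), (∀ y, ‖f y‖ ≤ F) → 0 ≤ D →
          (∀ y, f y ≠ 0 → D ≤ B5Ineq137Torus.T P 0 x y) →
          ‖(gBox (B1RG242Torus.α P a k * (P.L : ℝ) ^ (k * P.d)) P.eps⁻¹ U k (cube α) *ᵥ f) x‖ ≤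
            P.spacing k ^ 2 * (c₀ * Real.exp (-(δ₀ * (((P.L : ℝ) ^ k)⁻¹ * D))) * F)) →
      (∀ α, ∀ x ∈ cube α, ∀ (f : Balaban1983to89.Site P 0 → ℂ) (F D : ℝ), (∀ y, ‖f y‖ ≤ F) → 0 ≤ D →
          (∀ y, f y ≠ 0 → D ≤ B5Ineq137Torus.T P 0 x y) →
          ‖(gBox (B1RG242Torus.α P a k * (P.L : ℝ) ^ (k * P.d)) P.eps⁻¹ U k Ω *ᵥ f) x‖ ≤
            P.spacing k ^ 2 * (c₀ * Real.exp (-(δ₀ * (((P.L : ℝ) ^ k)⁻¹ * D))) * F)) →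
      ∀ α, ∀ x ∈ Xr α, ∀ (f : Balaban1983to89.Site P 0 → ℂ) (F D Db Df : ℝ), (∀ y, ‖f y‖ ≤ F) → (∀ y, y ∉ cube α → f y = 0) →
        0 ≤ D → (∀ y, f y ≠ 0 → D ≤ B5Ineq137Torus.T P 0 x y) → 0 ≤ Db → (∀ w, w ∉ cube α → Db ≤ B5Ineq137Torus.T P 0 x w) →
        0 ≤ Df → (∀ y, f y ≠ 0 → ∀ w, w ∉ cube α → Df ≤ B5Ineq137Torus.T P 0 y w) →
        ‖(gBox (B1RG242Torus.α P a k * (P.L : ℝ) ^ (k * P.d)) P.eps⁻¹ U k (cube α) *ᵥ f) x -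
            (gBox (B1RG242Torus.α P a k * (P.L : ℝ) ^ (k * P.d)) P.eps⁻¹ U k Ω *ᵥ f) x‖ ≤
          P.spacing k ^ 2 * (c₁ * Real.exp (-(δ₁ * (((P.L : ℝ) ^ k)⁻¹ * D))) *
            Real.exp (-(δ₁ * (((P.L : ℝ) ^ k)⁻¹ * (Db + Df)))) * F) := by
  obtain ⟨c₁, δ₁, hc₁, hδ₁, h⟩ := close112_smoothNear_hC d L hd hd3 hL ha hc₀ hδ₀
  refine ⟨c₁, δ₁, hc₁, hδ₁, ?_⟩
  intro P hPd hPL k hk1 hkK U Ω ek η C pek hek hCp X Bd Pl hS hPl hBd hsmall T hTθ hsmall2 ι cube Xr hΩ hcube hsub hXr hGcube hGΩ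
  exact h P hPd hPL k hk1 hkK U Ω (ek * η ^ 2 * (C * pek)) (by positivity) (plaqSmall_near_of_smoothOn hek hS hPl hBd) hsmall T hTθ
    hsmall2 cube Xr hΩ hcube hsub hXr hGcube hGΩ

end Main

end

end Literature.MathematicalPhysics.QuantumFieldTheory.BalabanImbrieJaffe1984to88.BIJ88NeumannPropagatorSmoothNearClose
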